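import Summits.ResolutionOfSingularities.ResolutionOfSingularities.Theses.FoliationDescent
import Summits.ResolutionOfSingularities.ResolutionOfSingularities.Theorems.FoliationDescentFolLUStubSaturation
import Summits.ResolutionOfSingularities.ResolutionOfSingularities.Theorems.FoliationDescentFolLUStubRescalePClosed
import Summits.ResolutionOfSingularities.ResolutionOfSingularities.Theorems.FoliationDescentFolLUStubMultiplierInCtr
import Summits.ResolutionOfSingularities.ResolutionOfSingularities.Theorems.FoliationDescentFolLUSaturatedOfMultiplicative
import Summits.ResolutionOfSingularities.ResolutionOfSingularities.Theorems.FoliationDescentFolLUStubPreservesBlowupChart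
import Summits.ResolutionOfSingularities.ResolutionOfSingularities.Theorems.FoliationDescentFolLUStubRegularAtCtrBlowupChart
import Summits.ResolutionOfSingularities.ResolutionOfSingularities.Theorems.FoliationDescentFolLUCentreBridge
import Summits.ResolutionOfSingularities.ResolutionOfSingularities.Theorems.FoliationDescentFolLUStubEssFiniteType
import Literature.AlgebraicGeometry.Resolution.LocalBlowup
import Literature.AlgebraicGeometry.Resolution.QuadraticTransforms
import Literature.AlgebraicGeometry.Resolution.QuadraticTransformWeakTransform
import Literature.AlgebraicGeometry.Resolution.QuadraticSequenceDimOneExistence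
import HarnessLib
/-!
# Crux `FolLU` (stmt-ResolutionOfSingularities-17081) — line `birth`, lead's skeleton v10 (lead c1, 2026-08-17)

Route `ResolutionOfSingularities/FoliationDescent`, crux 2 (the transferred engine):
`FolLU` = FOLIATION LOCAL UNIFORMIZATION — over a perfect field `k` of characteristic `p`, along a
valuation ring `O` of `K/k`, a finitely generated model `S ≤ O` of `K`, regular at the centre, and a
nonzero `p`-closed `k`-derivation `D` of `K` admit a finitely generated model `S ≤ S' ≤ O`, still
regular at the centre, and a rescaling `g • D` (`g ≠ 0`) mapping the local ring `S'_c` into itself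
which is there LOG-CANONICAL: NON-SINGULAR (some value is a unit) or MULTIPLICATIVE
(`(g • D)^p = u · (g • D)`, `u` a unit of `S'_c`).

## History
v1 (planner): saturation / order reduction / nilpotent exit. v2–v8 (lead gen 1): the normalisation
split into `stub_saturation`, `stub_rescale_pClosed`, `stub_multiplier_inCtr` (ALL LANDED: p167040,
p167197, p167070), `stub_satMult` (p166977), blow-up chart infrastructure (p168463, p168465), centre
bridge (p168362), FolLU at essentially-finite-type valuation rings (p168973), Hochschild's formula and
the degree theorem `[K : K^D] = p` in Literature (p168497, p168993). The open core was isolated as ONE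
statement `AdditiveExitStatement` (= `FolLU` on saturated additive input; glue `FolLU_of_additiveExit`
certified sorry-free).

## v9 (lead c1): RESHAPE of the open core by transcendence degree

`AdditiveExitStatement` is split (pure logic, `additiveExit_of_lowHigh`) into
* `stub_additiveExitLow`  — `Algebra.trdeg k K ≤ 2`: **PROVABLE**, by a VALUATIVE WEAK SEIDENBERG
  THEOREM for derivations of a two-dimensional regular local ring along a valuation (below);
* `stub_additiveExitHigh` — `¬ Algebra.trdeg k K ≤ 2`: the OPEN PROBLEM (Posva, arXiv:2405.05735,
  Rem. 5.2.2: already for threefolds over `k = k̄` no proof is in print unless the singular locus is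
  a regular curve), kept as the honest open stub of the line.

### The low-dimensional engine (registered CORE stubs, not load-bearing for `FolLU_of` except through
### `stub_additiveExitLow`, whose proof file imports their landed files)

STATE at a two-dimensional regular local ring `R ⊆ K` dominated by `O`, with a regular system of
parameters `(x, y)`, a derivation `D` of `K` with `D(R) ⊆ R·Dx + R·Dy` (VAL), and a "boundary":
FREE (`E = {x = 0}`) or CROSSING (`E = {xy = 0}`). The LOG PAIR `(A, B) ∈ R²` — the primitive vector of
coefficients, in the logarithmic basis `dx/x, dy` resp. `dx/x, dy/y`, of the 1-form dual to `D` — is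
recorded by the single linear relation
  FREE: `A·Dx + x·B·Dy = 0`,   CROSSING: `A·y·Dx + B·x·Dy = 0`,
together with FINITE COLENGTH of `(A, B)` (relative primality). POTENTIAL `c = λ_R(R/(A,B))`
(Giraud 1983, 2.1–2.2: `c(X, ω, ξ)`). ADDITIVE(R, D): every multiple `gD ↷ R` is singular with nilpotent
linear part on `𝔪/𝔪²`. GOOD(R, D): some `gD ↷ R` (`g ≠ 0`) is NON-SINGULAR, or singular, SATURATED and
with NON-NILPOTENT linear part (for a `p`-closed `D` the latter is MULTIPLICATIVE: `L^p = c̄ L`).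
* `stub_lengthWeakTransform` (Lemma Č — Giraud 1983 Lemma 2.1.1 at ONE point of ONE chart, WITHOUT
  the Huneke–Swanson hypothesis "`in(x)` does not divide the content"): for `J ⊆ 𝔪^r`, `J ⊄ 𝔪^{r+1}`
  of finite colength and any prime `Q` of the chart `R[y/x]`:
  `λ(R[y/x]_Q / J^w) + λ(R/𝔪^r) ≤ λ(R/J)`, `J^w = (J·R[y/x] : x^r)`.
* `stub_crossingStep` (Giraud 2.3 (i), one-point): CROSSING, `(A,B) ≠ R`, `v(x) ≤ v(y)` ⇒ the next
  state (CROSSING at the origin of the chart, FREE at a free point) has `c₁ < c`.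
* `stub_freeStepSame` (Giraud 2.3 (ii) + the lead's NILPOTENCY REFINEMENT replacing Giraud's exactness
  lemma 2.3 (iii)): FREE, ADDITIVE, `v(x) ≤ v(y)` ⇒ next state FREE with `c₁ < c` (cases `ord B < ord A`:
  the new pair contains the weak transform; `ord A = m ≥ 2`: `c₁ ≤ c − m(m−1)/2`; `ord A = m = 1`:
  nilpotency of the linear part forces `A ≡ a·x (mod 𝔪²)`, so `A/x` is a unit on the whole chart and
  `c₁ = 0`).
* `stub_freeStepOther` (Giraud 2.3 (ii)): FREE, `v(y) < v(x)` (next centre = the satellite point) ⇒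
  next state CROSSING with `c₁ ≤ c`.
* `stub_goodOfTop`: `(A, B) = R` ⇒ GOOD.
* `stub_sepParam`: at the centre of `O` on the chart `R[y/x]` (residue field of `R` perfect) there is a
  regular parameter `y₁` (with `𝔪₁ = (x, y₁)`) whose derivative is `unit · D(y/x) + R₁ · Dx` — the transport of (VAL) and of
  the log pair to `R₁`; fed to `stub_crossingStep` / `stub_freeStepSame` as a hypothesis.
* `stub_coreDescent` (the lead's): along an infinite sequence of two-dimensional quadratic transforms
  with perfect residue fields, some `R_n` is GOOD — `c ≥ 1` on additive states, non-increasing, and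
  strictly decreasing at least every second step.
* `stub_valSpan` ((VAL) at the centre of a f.g. model in transcendence degree 2 over a perfect field:
  dual derivations to a regular system of parameters, `DualDerivationsPrimeField.lean`, and
  `K = K^p(x, y)`), `stub_fgTower` (every member of the quadratic sequence of `S_c` along `O` is the
  local ring at the centre of a finitely generated model `S ≤ S_n ≤ O`).
`stub_additiveExitLow` is then: if some `R_n` has dimension `≤ 1`, `O` is essentially of finite type
(`stub_folLU_of_essFiniteType`, landed); otherwise `stub_coreDescent` gives a GOOD `R_n = (S_n)_c`, whose
non-singular branch is the crux's first clause and whose saturated non-nilpotent branch is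
MULTIPLICATIVE by `stub_rescale_pClosed` + `stub_multiplier_inCtr` (landed) + `L^p = c̄L`.
Numerical sanity check of every inequality above (all children of ~1900 additive states of exact
forms over `𝔽₂, 𝔽₃, 𝔽₅`): 0 violations (lead's folder `work/exp/potential.py`).

## Standing / Disproof used (`Cruxes/FolLU/Disproof.lean` v2.1, re-read 2026-08-17T18:30Z)
`p`-closedness is the one sharp hypothesis (it enters ONLY in the last line: non-nilpotent ⇒
multiplicative); `S' := S` refuted (Negative/SameModel: our engine blows up); the multiplicative exit
is necessary for `p ≥ 5` (our GOOD keeps it). `-- Targets`: none.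
-/

-- single-problem summit: the doubled namespace component `ResolutionOfSingularities` is forced
set_option linter.dupNamespace false

noncomputable section

open Summit.ResolutionOfSingularities.ResolutionOfSingularities.Theses.FoliationDescent
open scoped BigOperators

namespace Summit.ResolutionOfSingularities.ResolutionOfSingularities.Cruxes.FolLU.Lines.Birth

/-! ## Elementwise predicates (the route file's encoding of the local ring at the centre, named) -/

section Predicates

variable {k K : Type} [Field k] [Field K] [Algebra k K]

/-- `x ∈ S_c`, the local ring of the model `S` at the centre of `O`: fractions `a / b` with
`a b ∈ S` and `b` a unit of `O` — verbatim the route file's clause. [folklore] -/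
def InCtr (O : ValuationSubring K) (S : Subalgebra k K) (x : K) : Prop :=
  ∃ a b : K, a ∈ S ∧ b ∈ S ∧ b ≠ 0 ∧ b⁻¹ ∈ O ∧ x = a / b

/-- `x` is a unit of `O` (for `x ∈ S_c`: a unit of the local ring `S_c`). [folklore] -/
def IsCtrUnit (O : ValuationSubring K) (x : K) : Prop :=
  x ≠ 0 ∧ x⁻¹ ∈ O

/-- `x ∈ m_c = S_c ∩ m_O`, the maximal ideal of the local ring at the centre. [folklore] -/
def InCtrMax (O : ValuationSubring K) (S : Subalgebra k K) (x : K) : Prop :=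
  InCtr O S x ∧ ¬ IsCtrUnit O x

/-- `x ∈ m_c ^ 2`: a finite sum of products of two elements of `m_c`. [folklore] -/
def InCtrMaxSq (O : ValuationSubring K) (S : Subalgebra k K) (x : K) : Prop :=
  ∃ (n : ℕ) (a b : Fin n → K), (∀ i, InCtrMax O S (a i)) ∧ (∀ i, InCtrMax O S (b i)) ∧
    x = ∑ i, a i * b i

/-- `S` is regular at the centre of `O` — verbatim the route file's clause
(`S_c = S_𝔭`, `𝔭 = S ∩ m_O`, is a regular local ring). [folklore] -/
def RegularAtCtr (O : ValuationSubring K) (S : Subalgebra k K)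
    (hS : S.toSubring ≤ O.toSubring) : Prop :=
  IsRegularLocalRing
    (Localization.AtPrime (Ideal.comap (Subring.inclusion hS) (IsLocalRing.maximalIdeal O)))

/-- The derivation `δ` of `K` maps `S_c` into itself. [folklore] -/
def Preserves (O : ValuationSubring K) (S : Subalgebra k K) (δ : Derivation k K K) : Prop :=
  ∀ x : K, InCtr O S x → InCtr O S (δ x)

/-- `δ` is NON-SINGULAR at the centre: some value on `S_c` is a unit — verbatim the route file's
clause. [cite: arXiv:2405.05735, §2 (regular / singular points of 1-foliations)] -/
def NonSingular (O : ValuationSubring K) (S : Subalgebra k K) (δ : Derivation k K K) : Prop :=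
  ∃ x : K, InCtr O S x ∧ δ x ≠ 0 ∧ (δ x)⁻¹ ∈ O

/-- `c ∈ S_c` is a `p`-MULTIPLIER of `δ`: `δ^p = c · δ` on `K` (for a unit `c` this is verbatim
the route file's MULTIPLICATIVE clause). [cite: doi:10.1070/im1976v010n06abeh001833, §1] -/
def IsMultiplier (p : ℕ) (O : ValuationSubring K) (S : Subalgebra k K) (δ : Derivation k K K)
    (c : K) : Prop :=
  InCtr O S c ∧ ∀ x : K, (⇑δ)^[p] x = c * δ x

/-- `δ` is SATURATED at the centre: for every nonzero non-unit `t ∈ m_c` some value `δ x`,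
`x ∈ S_c`, is not divisible by `t` in `S_c` (the values have no common non-unit factor).
[cite: arXiv:2311.16694, §2 (saturated 1-foliations)] -/
def Saturated (O : ValuationSubring K) (S : Subalgebra k K) (δ : Derivation k K K) : Prop :=
  ∀ t : K, InCtrMax O S t → t ≠ 0 → ∃ x : K, InCtr O S x ∧ ¬ InCtr O S (δ x / t)

/-- `δ` has ZERO LINEAR PART at the centre (order ≥ 2): `δ (m_c) ⊆ m_c ^ 2`, i.e. the induced
endomorphism of `m_c / m_c²` vanishes. [cite: doi:10.2307/2373435 (order of a vector field at a
point)] -/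
def ZeroLinearPart (O : ValuationSubring K) (S : Subalgebra k K) (δ : Derivation k K K) : Prop :=
  ∀ x : K, InCtrMax O S x → InCtrMaxSq O S (δ x)

/-- `FolLU`'s conclusion at `(p, O, S, D)`, verbatim modulo the named predicates: a dominating
f.g. model regular at the centre with a log-canonical rescaling of `D`. [folklore] -/
def Conclusion (p : ℕ) (O : ValuationSubring K) (S : Subalgebra k K) (D : Derivation k K K) :
    Prop :=
  ∃ (S' : Subalgebra k K) (h' : S'.toSubring ≤ O.toSubring) (g : K), S ≤ S' ∧ S'.FG ∧
    IsFractionRing S' K ∧ RegularAtCtr O S' h' ∧ g ≠ 0 ∧ Preserves O S' (g • D) ∧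
    (NonSingular O S' (g • D) ∨
      ∃ u : K, InCtr O S' u ∧ u ≠ 0 ∧ u⁻¹ ∈ O ∧ ∀ x : K, (⇑(g • D))^[p] x = u * (g • D) x)

end Predicates

/-- Unfolding: the crux is `∀ p prime, ∀ (k, K, O, S ≤ O, D)` with the route's hypotheses,
`Conclusion p O S D` (δ-reduction of the named predicates; certified by `Iff.rfl`). [folklore] -/
theorem folLU_iff :
    FolLU ↔ ∀ p : ℕ, p.Prime → ∀ (k K : Type) [Field k] [CharP k p] [PerfectField k] [Field K]
      [Algebra k K] (O : ValuationSubring K) (S : Subalgebra k K) (hS : S.toSubring ≤ O.toSubring)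
      (D : Derivation k K K), S.FG → IsFractionRing S K → RegularAtCtr O S hS → D ≠ 0 →
      (∃ c : K, ∀ x : K, (⇑D)^[p] x = c * D x) → Conclusion p O S D :=
  Iff.rfl

/-! ## The five stub statements as named propositions -/

/-- Statement of `stub_saturation` (PROVABLE): a saturated rescaling of `D` preserving the local
ring of the given model. [cite: arXiv:2311.16694, §2; doi:10.1070/im1976v010n06abeh001833, §1] -/
def SaturationStatement : Prop :=
  ∀ p : ℕ, p.Prime → ∀ (k K : Type) [Field k] [CharP k p] [PerfectField k] [Field K] [Algebra k K]
    (O : ValuationSubring K) (S : Subalgebra k K) (hS : S.toSubring ≤ O.toSubring)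
    (D : Derivation k K K), S.FG → IsFractionRing S K → RegularAtCtr O S hS → D ≠ 0 →
    (∃ c : K, ∀ x : K, (⇑D)^[p] x = c * D x) →
    ∃ g : K, g ≠ 0 ∧ Preserves O S (g • D) ∧ Saturated O S (g • D)

/-- Statement of `stub_rescale_pClosed` (PROVABLE): `p`-closedness is stable under rescaling by
a function — the corollary `(gD)^p ∈ K · D` of Hochschild's formula
`(gD)^p = g^p D^p + (gD)^{p-1}(g) · D`. [cite: Hochschild1955, Lemma 1] -/
def RescalePClosedStatement : Prop :=
  ∀ p : ℕ, p.Prime → ∀ (k K : Type) [Field k] [CharP k p] [Field K] [Algebra k K]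
    (D : Derivation k K K), (∃ c : K, ∀ x : K, (⇑D)^[p] x = c * D x) →
    ∀ g : K, ∃ c' : K, ∀ x : K, (⇑(g • D))^[p] x = c' * (g • D) x

/-- Statement of `stub_multiplier_inCtr` (PROVABLE): the `p`-multiplier of a non-zero saturated
derivation preserving the regular local ring `S_c` lies in `S_c` (lowest terms in the UFD `S_c`;
the denominator divides every value). [cite: doi:10.1070/im1976v010n06abeh001833, §1] -/
def MultiplierInCtrStatement : Prop :=
  ∀ p : ℕ, p.Prime → ∀ (k K : Type) [Field k] [Field K] [Algebra k K]
    (O : ValuationSubring K) (S : Subalgebra k K) (hS : S.toSubring ≤ O.toSubring)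
    (δ : Derivation k K K) (c : K), S.FG → IsFractionRing S K → RegularAtCtr O S hS → δ ≠ 0 →
    Preserves O S δ → Saturated O S δ → (∀ x : K, (⇑δ)^[p] x = c * δ x) → InCtr O S c

/-- Statement of `stub_orderReduction` (OPEN from dimension 3): from an additive point of order
≥ 2 reach, along `O`, a regular dominating model where the saturated transform is non-singular,
multiplicative, or of order one. [cite: doi:10.2307/2373435; doi:10.1007/s13398-013-0117-7;
arXiv:2405.05735, Thm. 1] -/
def OrderReductionStatement : Prop :=
  ∀ p : ℕ, p.Prime → ∀ (k K : Type) [Field k] [CharP k p] [PerfectField k] [Field K] [Algebra k K]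
    (O : ValuationSubring K) (S : Subalgebra k K) (hS : S.toSubring ≤ O.toSubring)
    (D : Derivation k K K) (g c : K), S.FG → IsFractionRing S K → RegularAtCtr O S hS → D ≠ 0 →
    (∃ c₀ : K, ∀ x : K, (⇑D)^[p] x = c₀ * D x) →
    g ≠ 0 → Preserves O S (g • D) → Saturated O S (g • D) → ¬ NonSingular O S (g • D) →
    IsMultiplier p O S (g • D) c → ¬ IsCtrUnit O c → ZeroLinearPart O S (g • D) →
    ∃ (S' : Subalgebra k K) (h' : S'.toSubring ≤ O.toSubring) (g' c' : K),
      S ≤ S' ∧ S'.FG ∧ IsFractionRing S' K ∧ RegularAtCtr O S' h' ∧ g' ≠ 0 ∧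
      Preserves O S' (g' • D) ∧ Saturated O S' (g' • D) ∧ IsMultiplier p O S' (g' • D) c' ∧
      (NonSingular O S' (g' • D) ∨ IsCtrUnit O c' ∨ ¬ ZeroLinearPart O S' (g' • D))

/-- Statement of `stub_nilpotentExit` (OPEN from dimension 3): from an additive point of order
one (nonzero nilpotent linear part) reach, along `O`, a regular dominating model where a rescaling
of `D` is non-singular or multiplicative. [cite: arXiv:2405.05735, Thm. 1; arXiv:2311.16694,
Thm. 7; doi:10.4310/jdg/1376053448] -/
def NilpotentExitStatement : Prop :=
  ∀ p : ℕ, p.Prime → ∀ (k K : Type) [Field k] [CharP k p] [PerfectField k] [Field K] [Algebra k K]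
    (O : ValuationSubring K) (S : Subalgebra k K) (hS : S.toSubring ≤ O.toSubring)
    (D : Derivation k K K) (g c : K), S.FG → IsFractionRing S K → RegularAtCtr O S hS → D ≠ 0 →
    (∃ c₀ : K, ∀ x : K, (⇑D)^[p] x = c₀ * D x) →
    g ≠ 0 → Preserves O S (g • D) → Saturated O S (g • D) → ¬ NonSingular O S (g • D) →
    IsMultiplier p O S (g • D) c → ¬ IsCtrUnit O c → ¬ ZeroLinearPart O S (g • D) →
    ∃ (S' : Subalgebra k K) (h' : S'.toSubring ≤ O.toSubring) (g' c' : K),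
      S ≤ S' ∧ S'.FG ∧ IsFractionRing S' K ∧ RegularAtCtr O S' h' ∧ g' ≠ 0 ∧
      Preserves O S' (g' • D) ∧
      (NonSingular O S' (g' • D) ∨ (IsMultiplier p O S' (g' • D) c' ∧ IsCtrUnit O c'))

/-! ## The stubs -/

/-- STUB `stub_saturation` (LANDED p167040, `Theorems/FoliationDescentFolLUStubSaturation.lean`, wave-1 worker). **Saturated rescaling on the local ring at the
centre.** `O` a valuation ring of `K ⊇ k`, `S ≤ O` a f.g. `k`-subalgebra with `Frac S = K`, regular
at the centre, `D ≠ 0`. Then some `g ≠ 0` has `g • D (S_c) ⊆ S_c` with no non-zero non-unit of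
`S_c` dividing all the values `g • D (x)`, `x ∈ S_c`. Proof route: `D sᵢ = aᵢ/bᵢ` on generators
(`Frac S = K`), `g₀ := ∏ bᵢ` gives `g₀ D (S) ⊆ S` (the set `{x | g₀ D x ∈ S}` is a `k`-subalgebra),
hence `g₀ D (S_c) ⊆ S_c` by the quotient rule (denominators are units of `O`); `S_c` (the route's
`Localization.AtPrime`, realised inside `K`) is regular local, hence a UFD
(`IsRegularLocalRing` ⇒ `UniqueFactorizationMonoid`, in tree); the ideal of values is finitely
generated (Noetherian), let `f` be a gcd of finitely many generating values, `g := g₀ / f`; then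
`g • D ↷ S_c` and a common non-unit divisor `t` of all values would make `t f` divide the
generating values, i.e. `t ∣ unit`. (`O = K`: `m_c = 0`, saturation is vacuous.)
[cite: arXiv:2311.16694, §2; doi:10.1070/im1976v010n06abeh001833, §1] -/
theorem stub_saturation :
  ∀ p : ℕ, p.Prime → ∀ (k K : Type) [Field k] [CharP k p] [PerfectField k] [Field K] [Algebra k K]
    (O : ValuationSubring K) (S : Subalgebra k K) (hS : S.toSubring ≤ O.toSubring)
    (D : Derivation k K K), S.FG → IsFractionRing S K →
    IsRegularLocalRing
      (Localization.AtPrime (Ideal.comap (Subring.inclusion hS) (IsLocalRing.maximalIdeal O))) →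
    D ≠ 0 → (∃ c : K, ∀ x : K, (⇑D)^[p] x = c * D x) →
    ∃ g : K, g ≠ 0 ∧
      (∀ x : K, (∃ a b : K, a ∈ S ∧ b ∈ S ∧ b ≠ 0 ∧ b⁻¹ ∈ O ∧ x = a / b) →
        ∃ a b : K, a ∈ S ∧ b ∈ S ∧ b ≠ 0 ∧ b⁻¹ ∈ O ∧ (g • D) x = a / b) ∧
      (∀ t : K, ((∃ a b : K, a ∈ S ∧ b ∈ S ∧ b ≠ 0 ∧ b⁻¹ ∈ O ∧ t = a / b) ∧ ¬ (t ≠ 0 ∧ t⁻¹ ∈ O)) →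
        t ≠ 0 → ∃ x : K, (∃ a b : K, a ∈ S ∧ b ∈ S ∧ b ≠ 0 ∧ b⁻¹ ∈ O ∧ x = a / b) ∧
          ¬ (∃ a b : K, a ∈ S ∧ b ∈ S ∧ b ≠ 0 ∧ b⁻¹ ∈ O ∧ (g • D) x / t = a / b)) :=
  Summit.ResolutionOfSingularities.ResolutionOfSingularities.Theorems.FolLU.stub_saturation

/-- STUB `stub_rescale_pClosed` (LANDED p167197, `Theorems/FoliationDescentFolLUStubRescalePClosed.lean`, wave-1 worker; Hochschild's formula proved in full as `…Theorems.FolLU.Hochschild.formula`). **Rescaling preserves `p`-closedness.** For a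
`k`-derivation `D` of a field `K ⊇ k` of characteristic `p` with `D^p = c · D` and any `g ∈ K`,
`(g • D)^p = c' · (g • D)` for some `c' ∈ K` — namely `c' = g^{p-1} c + (gD)^{p-1}(g) / g`
(`g ≠ 0`; for `g = 0` anything), by HOCHSCHILD'S FORMULA `(gD)^p = g^p D^p + (gD)^{p-1}(g) · D`,
valid for a derivation of any commutative ring of prime characteristic `p`. Proof route for the
formula: expand `(gD)^n = ∑_{1 ≤ i ≤ n} B(n,i) Dⁱ` (`B(n+1,i) = g (D B(n,i) + B(n,i-1))`,
`B(n,n) = gⁿ`, `B(n,1) = (gD)^{n-1} g`); in the universal differential algebra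
`𝔽_p[g_j, x_j, y_j]` the operator `(gD)^p − g^p D^p − (gD)^{p-1}(g) D = ∑_{2 ≤ i ≤ p-1} B(p,i) Dⁱ`
is a DERIVATION (p-th powers of derivations are derivations in characteristic `p`), and its Leibniz
defect on `x₀ y₀` has coefficient `i · B(p,i)` at `x₁ y_{i-1}`, forcing `B(p,i) = 0`; specialise.
(Equivalently: the coefficients are partial Bell polynomials, `p ∣ p!/(∏ j_m! (m!)^{j_m})`.)
[cite: Hochschild1955, Lemma 1] -/
theorem stub_rescale_pClosed :
  ∀ p : ℕ, p.Prime → ∀ (k K : Type) [Field k] [CharP k p] [Field K] [Algebra k K]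
    (D : Derivation k K K), (∃ c : K, ∀ x : K, (⇑D)^[p] x = c * D x) →
    ∀ g : K, ∃ c' : K, ∀ x : K, (⇑(g • D))^[p] x = c' * (g • D) x :=
  Summit.ResolutionOfSingularities.ResolutionOfSingularities.Theorems.FolLU.stub_rescale_pClosed

/-- STUB `stub_multiplier_inCtr` (LANDED p167070, `Theorems/FoliationDescentFolLUStubMultiplierInCtr.lean`, wave-1 worker). **The multiplier of a saturated derivation
lies in the local ring.** If `δ ≠ 0` maps `S_c` into itself (`S_c` regular local, a UFD), is
saturated there, and `δ^p = c · δ` on `K`, then `c ∈ S_c`: `c · δ x = δ^p x ∈ S_c` for `x ∈ S_c`;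
write `c = a / b` in lowest terms in the UFD `S_c`; then `b ∣ δ x` for every `x ∈ S_c`, so `b` is
a unit by saturation (a non-unit `b ∈ m_c`, `b ≠ 0`, would divide all values), i.e. `c ∈ S_c`.
(`m_c = 0`, i.e. `S_c = K`: `c = c/1` with `Frac S = K`.)
[cite: doi:10.1070/im1976v010n06abeh001833, §1] -/
theorem stub_multiplier_inCtr :
  ∀ p : ℕ, p.Prime → ∀ (k K : Type) [Field k] [Field K] [Algebra k K]
    (O : ValuationSubring K) (S : Subalgebra k K) (hS : S.toSubring ≤ O.toSubring)
    (δ : Derivation k K K) (c : K), S.FG → IsFractionRing S K →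
    IsRegularLocalRing
      (Localization.AtPrime (Ideal.comap (Subring.inclusion hS) (IsLocalRing.maximalIdeal O))) →
    δ ≠ 0 →
    (∀ x : K, (∃ a b : K, a ∈ S ∧ b ∈ S ∧ b ≠ 0 ∧ b⁻¹ ∈ O ∧ x = a / b) →
      ∃ a b : K, a ∈ S ∧ b ∈ S ∧ b ≠ 0 ∧ b⁻¹ ∈ O ∧ δ x = a / b) →
    (∀ t : K, ((∃ a b : K, a ∈ S ∧ b ∈ S ∧ b ≠ 0 ∧ b⁻¹ ∈ O ∧ t = a / b) ∧ ¬ (t ≠ 0 ∧ t⁻¹ ∈ O)) →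
      t ≠ 0 → ∃ x : K, (∃ a b : K, a ∈ S ∧ b ∈ S ∧ b ≠ 0 ∧ b⁻¹ ∈ O ∧ x = a / b) ∧
        ¬ (∃ a b : K, a ∈ S ∧ b ∈ S ∧ b ≠ 0 ∧ b⁻¹ ∈ O ∧ δ x / t = a / b)) →
    (∀ x : K, (⇑δ)^[p] x = c * δ x) →
    ∃ a b : K, a ∈ S ∧ b ∈ S ∧ b ≠ 0 ∧ b⁻¹ ∈ O ∧ c = a / b :=
  Summit.ResolutionOfSingularities.ResolutionOfSingularities.Theorems.FolLU.stub_multiplier_inCtr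

/-- STUB `stub_satMult` (LANDED p166977 by the lead, file `Theorems/FoliationDescentFolLUSaturatedOfMultiplicative.lean`;
registered so that it lands `--supports` this crux; NOT load-bearing for `FolLU_of`). **A multiplicative
derivation divisible by a non-unit has non-singular saturation**: `R` a local UFD (hence a domain), `d ≠ 0` a
derivation of `R`, `f ≠ 0` a non-unit, `u` a unit, `p ≥ 2`, `(f • d)^[p] = u · (f • d)` on `R`
⇒ some value `d x` is a unit. It certifies that the conclusion of `FolLU` is always attained by the
SATURATED rescaling, hence `FolLU ∧ stub_saturation ⇒ stub_orderReduction ∧ stub_nilpotentExit`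
(the cut loses nothing), and it is the saturation step of `LogCanQuotLU`'s multiplicative case.
[folklore] -/
theorem stub_satMult :
    ∀ {R : Type} [CommRing R] [IsLocalRing R] [UniqueFactorizationMonoid R]
    (d : Derivation ℤ R R), d ≠ 0 → ∀ {p : ℕ}, 2 ≤ p → ∀ {f u : R}, f ≠ 0 → ¬ IsUnit f → IsUnit u →
    (∀ x : R, (⇑(f • d))^[p] x = u * (f • d) x) → ∃ x : R, IsUnit (d x) :=
  Summit.ResolutionOfSingularities.ResolutionOfSingularities.Theorems.FolLU.SatMult.stub_satMult


/-! ## Cycle-2 registered lemmas (infrastructure; not load-bearing for `FolLU_of`) -/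

/-- STUB `stub_preserves_blowupChart` (LANDED p168463, `Theorems/FoliationDescentFolLUStubPreservesBlowupChart.lean`, wave-2 worker). **Transform of a derivation under an
affine blow-up chart.** If `g • D` maps `S_c` into itself, `Z ⊆ S` is finite and `x₁ ∈ S` is
non-zero, then the rescaling `(x₁ g) • D` maps `S'_c` into itself, where
`S' = S[z/x₁ : z ∈ Z]` is the chart ring of the blow-up of the ideal `(Z)`: on generators
`(x₁ g D)(s) = x₁ · gD s` and `(x₁ g D)(z/x₁) = gD z − (z/x₁) · gD x₁`, then Leibniz and the
quotient rule. (No regularity and no valuation-theoretic hypothesis is needed.) This is the first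
half of the bookkeeping of every blow-up step of an attack on stubs 4–5 (the saturated transform is
`x₁^{1-ν} g • D`, obtained from this one by `stub_saturation`). [folklore] -/
theorem stub_preserves_blowupChart :
    ∀ (k K : Type) [Field k] [Field K] [Algebra k K] (O : ValuationSubring K) (S : Subalgebra k K)
    (D : Derivation k K K) (g x₁ : K) (Z : Finset K), (↑Z : Set K) ⊆ S → x₁ ∈ S → x₁ ≠ 0 →
    (∀ x : K, (∃ a b : K, a ∈ S ∧ b ∈ S ∧ b ≠ 0 ∧ b⁻¹ ∈ O ∧ x = a / b) →
      ∃ a b : K, a ∈ S ∧ b ∈ S ∧ b ≠ 0 ∧ b⁻¹ ∈ O ∧ (g • D) x = a / b) →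
    ∀ x : K, (∃ a b : K, a ∈ Algebra.adjoin k (↑S ∪ (fun z => z / x₁) '' ↑Z) ∧
        b ∈ Algebra.adjoin k (↑S ∪ (fun z => z / x₁) '' ↑Z) ∧ b ≠ 0 ∧ b⁻¹ ∈ O ∧ x = a / b) →
      ∃ a b : K, a ∈ Algebra.adjoin k (↑S ∪ (fun z => z / x₁) '' ↑Z) ∧
        b ∈ Algebra.adjoin k (↑S ∪ (fun z => z / x₁) '' ↑Z) ∧ b ≠ 0 ∧ b⁻¹ ∈ O ∧
        ((x₁ * g) • D) x = a / b :=
  Summit.ResolutionOfSingularities.ResolutionOfSingularities.Theorems.FolLU.stub_preserves_blowupChart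

/-- STUB `stub_regularAtCtr_blowupChart` (LANDED p168465, `Theorems/FoliationDescentFolLUStubRegularAtCtrBlowupChart.lean`, wave-2 worker). **The chart of the blow-up of a
regular centre, re-localised at the new centre of the valuation, is regular** (Liu, *Algebraic
Geometry and Arithmetic Curves*, Thm. 8.1.19 (a); in tree at ring level:
`Literature/AlgebraicGeometry/Resolution/BlowupChartRegular.lean` `isRegularRing_blowupChart`,
`QuadraticTransformsRegular.lean` `isRegularRing_closure_of_isRegularRing_blowupChart` /
`isRegularLocalRing_locAtCentre_of_isRegularRing`). In the route's encoding: `S ≤ O` f.g. with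
`Frac S = K`, regular at the centre with local ring `R := S_c` (the displayed `Localization.AtPrime`);
`Z ⊆ W ⊆ S` finite, where the images of `W` form a REGULAR SYSTEM OF PARAMETERS of `R` (they
generate `𝔪_R` and `#W = embdim R`), so that `Z` is part of one (a regular centre through the
centre of `O`); `x₁ ∈ Z`, `x₁ ≠ 0`, and all `z/x₁ ∈ O` (the centre of `O` on the blow-up lies in the
`x₁`-chart). Then `S' := S[z/x₁ : z ∈ Z] ≤ O` is f.g., `Frac S' = K`, and `S'` is regular at the
centre of `O`. [cite: Liu2002, Thm. 8.1.19 (a)] -/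
theorem stub_regularAtCtr_blowupChart :
    ∀ (k K : Type) [Field k] [Field K] [Algebra k K] (O : ValuationSubring K) (S : Subalgebra k K)
    (hS : S.toSubring ≤ O.toSubring) (Z : Finset K) (x₁ : K),
    S.FG → IsFractionRing S K →
    IsRegularLocalRing
      (Localization.AtPrime (Ideal.comap (Subring.inclusion hS) (IsLocalRing.maximalIdeal O))) →
    x₁ ∈ Z → x₁ ≠ 0 → (∀ z ∈ Z, z / x₁ ∈ O) →
    (∃ (W : Finset K) (hW : (↑W : Set K) ⊆ S), Z ⊆ W ∧
      Ideal.span (Set.range fun w : (W : Set K) =>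
          algebraMap (↥S.toSubring)
            (Localization.AtPrime (Ideal.comap (Subring.inclusion hS) (IsLocalRing.maximalIdeal O)))
            ⟨(w : K), hW w.2⟩) =
        IsLocalRing.maximalIdeal
          (Localization.AtPrime (Ideal.comap (Subring.inclusion hS) (IsLocalRing.maximalIdeal O))) ∧
      (IsLocalRing.maximalIdeal
          (Localization.AtPrime
            (Ideal.comap (Subring.inclusion hS) (IsLocalRing.maximalIdeal O)))).spanFinrank = W.card) →
    ∃ h' : (Algebra.adjoin k (↑S ∪ (fun z => z / x₁) '' ↑Z)).toSubring ≤ O.toSubring,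
      S ≤ Algebra.adjoin k (↑S ∪ (fun z => z / x₁) '' ↑Z) ∧
      (Algebra.adjoin k (↑S ∪ (fun z => z / x₁) '' ↑Z)).FG ∧
      IsFractionRing ↥(Algebra.adjoin k (↑S ∪ (fun z => z / x₁) '' ↑Z)) K ∧
      IsRegularLocalRing
        (Localization.AtPrime (Ideal.comap (Subring.inclusion h') (IsLocalRing.maximalIdeal O))) :=
  Summit.ResolutionOfSingularities.ResolutionOfSingularities.Theorems.FolLU.stub_regularAtCtr_blowupChart

/-- STUB `stub_folLU_of_essFiniteType` (LANDED p168973, `Theorems/FoliationDescentFolLUStubEssFiniteType.lean`, wave-2 worker). **`FolLU` at valuation rings that are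
essentially of finite type** (the trivial valuation and the divisorial = prime-divisor valuations
whose ring is a local ring of a model): if some f.g. `S₀ ≤ O` has `(S₀)_c = O`, then the
conclusion of `FolLU` holds at `(p, O, S, D)` — with `S' := S ⊔ S₀` one has `S'_c = O`, a
Noetherian valuation ring, i.e. a DVR or a field, hence regular; `stub_saturation` gives a
saturated `g • D ↷ O`, and saturation in a DVR (test `t` = a uniformiser) or a field means some
value is a unit: NON-SINGULAR. This is the refuter's remark "FolLU is automatic at divisorial
valuations" made formal. [folklore] -/
theorem stub_folLU_of_essFiniteType :
    ∀ p : ℕ, p.Prime → ∀ (k K : Type) [Field k] [CharP k p] [PerfectField k] [Field K] [Algebra k K]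
    (O : ValuationSubring K) (S : Subalgebra k K) (hS : S.toSubring ≤ O.toSubring)
    (D : Derivation k K K), S.FG → IsFractionRing S K →
    IsRegularLocalRing
      (Localization.AtPrime (Ideal.comap (Subring.inclusion hS) (IsLocalRing.maximalIdeal O))) →
    D ≠ 0 → (∃ c : K, ∀ x : K, (⇑D)^[p] x = c * D x) →
    (∃ S₀ : Subalgebra k K, S₀.FG ∧ S₀.toSubring ≤ O.toSubring ∧
      ∀ x : K, x ∈ O → ∃ a b : K, a ∈ S₀ ∧ b ∈ S₀ ∧ b ≠ 0 ∧ b⁻¹ ∈ O ∧ x = a / b) →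
    ∃ (S' : Subalgebra k K) (h' : S'.toSubring ≤ O.toSubring) (g : K), S ≤ S' ∧ S'.FG ∧
      IsFractionRing S' K ∧
      IsRegularLocalRing
        (Localization.AtPrime (Ideal.comap (Subring.inclusion h') (IsLocalRing.maximalIdeal O))) ∧
      g ≠ 0 ∧
      (∀ x : K, (∃ a b : K, a ∈ S' ∧ b ∈ S' ∧ b ≠ 0 ∧ b⁻¹ ∈ O ∧ x = a / b) →
        ∃ a b : K, a ∈ S' ∧ b ∈ S' ∧ b ≠ 0 ∧ b⁻¹ ∈ O ∧ (g • D) x = a / b) ∧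
      ((∃ x : K, (∃ a b : K, a ∈ S' ∧ b ∈ S' ∧ b ≠ 0 ∧ b⁻¹ ∈ O ∧ x = a / b) ∧ (g • D) x ≠ 0 ∧
          ((g • D) x)⁻¹ ∈ O) ∨
        (∃ u : K, (∃ a b : K, a ∈ S' ∧ b ∈ S' ∧ b ≠ 0 ∧ b⁻¹ ∈ O ∧ u = a / b) ∧ u ≠ 0 ∧
          u⁻¹ ∈ O ∧ ∀ x : K, (⇑(g • D))^[p] x = u * (g • D) x)) :=
  Summit.ResolutionOfSingularities.ResolutionOfSingularities.Theorems.FolLU.stub_folLU_of_essFiniteType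

/-- STUB `stub_inCtr_iff_mem_locAtCentre` (LANDED p168362 by the lead, `Theorems/FoliationDescentFolLUCentreBridge.lean`). **The route's centre clause is membership in the tree's `locAtCentre`**: for
`S ≤ O`, `x = a/b` with `a b ∈ S`, `b ≠ 0`, `b⁻¹ ∈ O` iff `x ∈ locAtCentre S.toSubring O`
(`Literature/AlgebraicGeometry/Resolution/LocalBlowup.lean`). Makes quadratic transforms,
Abhyankar's factorization (`QuadraticTransforms*.lean`) and local blow-ups usable in the crux's
own vocabulary. [folklore] -/
theorem stub_inCtr_iff_mem_locAtCentre :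
    ∀ (k K : Type) [Field k] [Field K] [Algebra k K] (O : ValuationSubring K) (S : Subalgebra k K),
    S.toSubring ≤ O.toSubring → ∀ x : K,
    ((∃ a b : K, a ∈ S ∧ b ∈ S ∧ b ≠ 0 ∧ b⁻¹ ∈ O ∧ x = a / b) ↔
      x ∈ Literature.AlgebraicGeometry.Resolution.locAtCentre S.toSubring O) :=
  Summit.ResolutionOfSingularities.ResolutionOfSingularities.Theorems.FolLU.stub_inCtr_iff_mem_locAtCentre

/-! ## The composition: the crux from the five stub STATEMENTS (sorry-free closure) -/

set_option linter.defProp false in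
/-- **`FolLU` from the five stub statements** — pure logic, NO `sorry` in its closure: saturate
on the given model (stub 1), get the multiplier of the rescaling (stub 2) and put it in `S_c`
(stub 3); a non-singular or unit-multiplier (multiplicative) saturated derivation makes `S' := S`
a witness; otherwise the centre is an additive singular point — of order ≥ 2, sent by stub 4 to a
dominating regular model that is terminal or additive of order one, or already of order one — and
stub 5 finishes from additive order-one points (`S ≤ S₁ ≤ S'` by transitivity). (A `def`, not a
`theorem`, only so that the skeleton audit's unique crux-concluding theorem is `FolLU_of` below;
its type is the implication "stub statements ⇒ crux".) [folklore] -/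
def FolLU_of_stubs (h₁ : SaturationStatement) (h₁' : RescalePClosedStatement)
    (h₁'' : MultiplierInCtrStatement) (h₂ : OrderReductionStatement)
    (h₃ : NilpotentExitStatement) : FolLU := by
  refine folLU_iff.mpr ?_
  intro p hp k K _ _ _ _ _ O S hS D hfg hfrac hreg hD hpc
  -- stub 1: a saturated rescaling `g • D ↷ S_c`
  obtain ⟨g, hg, hpres, hsat⟩ := h₁ p hp k K O S hS D hfg hfrac hreg hD hpc
  -- stub 2: its multiplier `c` on `K`; stub 3: `c ∈ S_c`
  obtain ⟨c, hc⟩ := h₁' p hp k K D hpc g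
  have hgD : g • D ≠ 0 := by
    intro h0
    apply hD
    ext x
    have hx : (g • D) x = 0 := by rw [h0]; rfl
    rw [Derivation.smul_apply, smul_eq_mul] at hx
    rcases mul_eq_zero.mp hx with h | h
    · exact absurd h hg
    · simpa using h
  have hmul : IsMultiplier p O S (g • D) c :=
    ⟨h₁'' p hp k K O S hS (g • D) c hfg hfrac hreg hgD hpres hsat hc, hc⟩
  -- terminal case (i): non-singular on the given model
  rcases Classical.em (NonSingular O S (g • D)) with hns | hsing
  · exact ⟨S, hS, g, le_rfl, hfg, hfrac, hreg, hg, hpres, Or.inl hns⟩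
  -- terminal case (ii): multiplicative on the given model (unit multiplier)
  rcases Classical.em (IsCtrUnit O c) with hu | hadd
  · exact ⟨S, hS, g, le_rfl, hfg, hfrac, hreg, hg, hpres, Or.inr ⟨c, hmul.1, hu.1, hu.2, hmul.2⟩⟩
  -- additive singular point. Stub 5 finishes from any additive point of ORDER ONE on any
  -- dominating model `S₁ ≥ S`:
  have exit₁ : ∀ (S₁ : Subalgebra k K) (h₁' : S₁.toSubring ≤ O.toSubring) (g₁ c₁ : K),
      S ≤ S₁ → S₁.FG → IsFractionRing S₁ K → RegularAtCtr O S₁ h₁' → g₁ ≠ 0 →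
      Preserves O S₁ (g₁ • D) → Saturated O S₁ (g₁ • D) → ¬ NonSingular O S₁ (g₁ • D) →
      IsMultiplier p O S₁ (g₁ • D) c₁ → ¬ IsCtrUnit O c₁ → ¬ ZeroLinearPart O S₁ (g₁ • D) →
      Conclusion p O S D := by
    intro S₁ h₁' g₁ c₁ hle₁ hfg₁ hfrac₁ hreg₁ hg₁ hpres₁ hsat₁ hsing₁ hmul₁ hadd₁ hlin₁
    obtain ⟨S', h', g', c', hle', hfg', hfrac', hreg', hg', hpres', hterm⟩ :=
      h₃ p hp k K O S₁ h₁' D g₁ c₁ hfg₁ hfrac₁ hreg₁ hD hpc hg₁ hpres₁ hsat₁ hsing₁ hmul₁ hadd₁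
        hlin₁
    refine ⟨S', h', g', hle₁.trans hle', hfg', hfrac', hreg', hg', hpres', ?_⟩
    rcases hterm with hns' | ⟨hm', hu'⟩
    · exact Or.inl hns'
    · exact Or.inr ⟨c', hm'.1, hu'.1, hu'.2, hm'.2⟩
  rcases Classical.em (ZeroLinearPart O S (g • D)) with hzero | hlin
  · -- order ≥ 2: stub 4 reaches a terminal point or an additive point of order one
    obtain ⟨S', h', g', c', hle', hfg', hfrac', hreg', hg', hpres', hsat', hmul', hexit⟩ :=
      h₂ p hp k K O S hS D g c hfg hfrac hreg hD hpc hg hpres hsat hsing hmul hadd hzero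
    rcases Classical.em (NonSingular O S' (g' • D)) with hns' | hsing'
    · exact ⟨S', h', g', hle', hfg', hfrac', hreg', hg', hpres', Or.inl hns'⟩
    rcases Classical.em (IsCtrUnit O c') with hu' | hadd'
    · exact ⟨S', h', g', hle', hfg', hfrac', hreg', hg', hpres',
        Or.inr ⟨c', hmul'.1, hu'.1, hu'.2, hmul'.2⟩⟩
    have hlin' : ¬ ZeroLinearPart O S' (g' • D) := by
      rcases hexit with h | h | h
      · exact absurd h hsing'
      · exact absurd h hadd'
      · exact h
    exact exit₁ S' h' g' c' hle' hfg' hfrac' hreg' hg' hpres' hsat' hsing' hmul' hadd' hlin'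
  · -- order one already on the given model
    exact exit₁ S hS g c le_rfl hfg hfrac hreg hg hpres hsat hsing hmul hadd hlin

-- (v9) `FolLU_of` is re-assembled below from the reshaped open core.

/-! ## Alternative composition for the planner: ONE open item `AdditiveExit` (stubs 4+5 merged) -/

/-- Statement of the recommended single open item `AdditiveExit`: from a saturated ADDITIVE point
(singular, non-unit multiplier — order not specified) reach, along `O`, a regular dominating model
where a rescaling of `D` is non-singular or multiplicative. `FolLU` restricted to saturated additive
input; `NilpotentExitStatement` with the hypothesis `¬ ZeroLinearPart` dropped. [folklore] -/
def AdditiveExitStatement : Prop :=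
  ∀ p : ℕ, p.Prime → ∀ (k K : Type) [Field k] [CharP k p] [PerfectField k] [Field K] [Algebra k K]
    (O : ValuationSubring K) (S : Subalgebra k K) (hS : S.toSubring ≤ O.toSubring)
    (D : Derivation k K K) (g c : K), S.FG → IsFractionRing S K → RegularAtCtr O S hS → D ≠ 0 →
    (∃ c₀ : K, ∀ x : K, (⇑D)^[p] x = c₀ * D x) →
    g ≠ 0 → Preserves O S (g • D) → Saturated O S (g • D) → ¬ NonSingular O S (g • D) →
    IsMultiplier p O S (g • D) c → ¬ IsCtrUnit O c →
    ∃ (S' : Subalgebra k K) (h' : S'.toSubring ≤ O.toSubring) (g' c' : K),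
      S ≤ S' ∧ S'.FG ∧ IsFractionRing S' K ∧ RegularAtCtr O S' h' ∧ g' ≠ 0 ∧
      Preserves O S' (g' • D) ∧
      (NonSingular O S' (g' • D) ∨ (IsMultiplier p O S' (g' • D) c' ∧ IsCtrUnit O c'))

/-- `AdditiveExit` is implied by the two registered open stubs (so it is not a stronger demand).
[folklore] -/
theorem additiveExit_of_stubs (h₂ : OrderReductionStatement) (h₃ : NilpotentExitStatement) :
    AdditiveExitStatement := by
  intro p hp k K _ _ _ _ _ O S hS D g c hfg hfrac hreg hD hpc hg hpres hsat hsing hmul hadd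
  rcases Classical.em (ZeroLinearPart O S (g • D)) with hzero | hlin
  · obtain ⟨S', h', g', c', hle', hfg', hfrac', hreg', hg', hpres', hsat', hmul', hexit⟩ :=
      h₂ p hp k K O S hS D g c hfg hfrac hreg hD hpc hg hpres hsat hsing hmul hadd hzero
    rcases Classical.em (NonSingular O S' (g' • D)) with hns' | hsing'
    · exact ⟨S', h', g', c', hle', hfg', hfrac', hreg', hg', hpres', Or.inl hns'⟩
    rcases Classical.em (IsCtrUnit O c') with hu' | hadd'
    · exact ⟨S', h', g', c', hle', hfg', hfrac', hreg', hg', hpres', Or.inr ⟨hmul', hu'⟩⟩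
    have hlin' : ¬ ZeroLinearPart O S' (g' • D) := by
      rcases hexit with h | h | h
      · exact absurd h hsing'
      · exact absurd h hadd'
      · exact h
    obtain ⟨S'', h'', g'', c'', hle'', hfg'', hfrac'', hreg'', hg'', hpres'', hterm⟩ :=
      h₃ p hp k K O S' h' D g' c' hfg' hfrac' hreg' hD hpc hg' hpres' hsat' hsing' hmul' hadd' hlin'
    exact ⟨S'', h'', g'', c'', hle'.trans hle'', hfg'', hfrac'', hreg'', hg'', hpres'', hterm⟩
  · exact h₃ p hp k K O S hS D g c hfg hfrac hreg hD hpc hg hpres hsat hsing hmul hadd hlin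

set_option linter.defProp false in
/-- **`FolLU` from `AdditiveExit` and the three LANDED normalisation stubs** — the glue the planner
needs to re-file the open core as one item (pure logic, sorry-free; a `def` so that `FolLU_of` stays
the unique crux-concluding theorem). [folklore] -/
def FolLU_of_additiveExit (h₁ : SaturationStatement) (h₁' : RescalePClosedStatement)
    (h₁'' : MultiplierInCtrStatement) (hA : AdditiveExitStatement) : FolLU := by
  refine folLU_iff.mpr ?_
  intro p hp k K _ _ _ _ _ O S hS D hfg hfrac hreg hD hpc
  obtain ⟨g, hg, hpres, hsat⟩ := h₁ p hp k K O S hS D hfg hfrac hreg hD hpc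
  obtain ⟨c, hc⟩ := h₁' p hp k K D hpc g
  have hgD : g • D ≠ 0 := by
    intro h0
    apply hD
    ext x
    have hx : (g • D) x = 0 := by rw [h0]; rfl
    rw [Derivation.smul_apply, smul_eq_mul] at hx
    rcases mul_eq_zero.mp hx with h | h
    · exact absurd h hg
    · simpa using h
  have hmul : IsMultiplier p O S (g • D) c :=
    ⟨h₁'' p hp k K O S hS (g • D) c hfg hfrac hreg hgD hpres hsat hc, hc⟩
  rcases Classical.em (NonSingular O S (g • D)) with hns | hsing
  · exact ⟨S, hS, g, le_rfl, hfg, hfrac, hreg, hg, hpres, Or.inl hns⟩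
  rcases Classical.em (IsCtrUnit O c) with hu | hadd
  · exact ⟨S, hS, g, le_rfl, hfg, hfrac, hreg, hg, hpres, Or.inr ⟨c, hmul.1, hu.1, hu.2, hmul.2⟩⟩
  obtain ⟨S', h', g', c', hle', hfg', hfrac', hreg', hg', hpres', hterm⟩ :=
    hA p hp k K O S hS D g c hfg hfrac hreg hD hpc hg hpres hsat hsing hmul hadd
  refine ⟨S', h', g', hle', hfg', hfrac', hreg', hg', hpres', ?_⟩
  rcases hterm with hns' | ⟨hm', hu'⟩
  · exact Or.inl hns'
  · exact Or.inr ⟨c', hm'.1, hu'.1, hu'.2, hm'.2⟩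

/-- Sanity: `AdditiveExit` together with the three LANDED stubs closes the crux. -/
example (hA : AdditiveExitStatement) : FolLU :=
  FolLU_of_additiveExit stub_saturation stub_rescale_pClosed stub_multiplier_inCtr hA

/-! ## v9: the reshaped open core — `AdditiveExit = Low (trdeg ≤ 2) ∨ High (trdeg ≥ 3)` -/

/-- `AdditiveExitStatement` restricted to `Algebra.trdeg k K ≤ 2` (surfaces, curves, points):
PROVABLE by the low-dimensional engine below. [cite: Giraud1983, Thm. 2.4 / Lemma 2.3;
arXiv:2405.05735, Thm. 4.0.1] -/
def AdditiveExitLowStatement : Prop :=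
  ∀ p : ℕ, p.Prime → ∀ (k K : Type) [Field k] [CharP k p] [PerfectField k] [Field K] [Algebra k K]
    (O : ValuationSubring K) (S : Subalgebra k K) (hS : S.toSubring ≤ O.toSubring)
    (D : Derivation k K K) (g c : K), S.FG → IsFractionRing S K → RegularAtCtr O S hS → D ≠ 0 →
    (∃ c₀ : K, ∀ x : K, (⇑D)^[p] x = c₀ * D x) → Algebra.trdeg k K ≤ 2 →
    g ≠ 0 → Preserves O S (g • D) → Saturated O S (g • D) → ¬ NonSingular O S (g • D) →
    IsMultiplier p O S (g • D) c → ¬ IsCtrUnit O c →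
    ∃ (S' : Subalgebra k K) (h' : S'.toSubring ≤ O.toSubring) (g' c' : K),
      S ≤ S' ∧ S'.FG ∧ IsFractionRing S' K ∧ RegularAtCtr O S' h' ∧ g' ≠ 0 ∧
      Preserves O S' (g' • D) ∧
      (NonSingular O S' (g' • D) ∨ (IsMultiplier p O S' (g' • D) c' ∧ IsCtrUnit O c'))

/-- `AdditiveExitStatement` restricted to `¬ Algebra.trdeg k K ≤ 2`: the OPEN PROBLEM from
dimension three on. [cite: arXiv:2405.05735, Rem. 5.2.2; arXiv:2311.16694, Thm. 7] -/
def AdditiveExitHighStatement : Prop :=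
  ∀ p : ℕ, p.Prime → ∀ (k K : Type) [Field k] [CharP k p] [PerfectField k] [Field K] [Algebra k K]
    (O : ValuationSubring K) (S : Subalgebra k K) (hS : S.toSubring ≤ O.toSubring)
    (D : Derivation k K K) (g c : K), S.FG → IsFractionRing S K → RegularAtCtr O S hS → D ≠ 0 →
    (∃ c₀ : K, ∀ x : K, (⇑D)^[p] x = c₀ * D x) → ¬ Algebra.trdeg k K ≤ 2 →
    g ≠ 0 → Preserves O S (g • D) → Saturated O S (g • D) → ¬ NonSingular O S (g • D) →
    IsMultiplier p O S (g • D) c → ¬ IsCtrUnit O c →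
    ∃ (S' : Subalgebra k K) (h' : S'.toSubring ≤ O.toSubring) (g' c' : K),
      S ≤ S' ∧ S'.FG ∧ IsFractionRing S' K ∧ RegularAtCtr O S' h' ∧ g' ≠ 0 ∧
      Preserves O S' (g' • D) ∧
      (NonSingular O S' (g' • D) ∨ (IsMultiplier p O S' (g' • D) c' ∧ IsCtrUnit O c'))

/-- The split is lossless (excluded middle on `Algebra.trdeg k K ≤ 2`). [folklore] -/
theorem additiveExit_of_lowHigh (hlow : AdditiveExitLowStatement)
    (hhigh : AdditiveExitHighStatement) : AdditiveExitStatement := by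
  intro p hp k K _ _ _ _ _ O S hS D g c hfg hfrac hreg hD hpc hg hpres hsat hsing hmul hadd
  by_cases htr : Algebra.trdeg k K ≤ 2
  · exact hlow p hp k K O S hS D g c hfg hfrac hreg hD hpc htr hg hpres hsat hsing hmul hadd
  · exact hhigh p hp k K O S hS D g c hfg hfrac hreg hD hpc htr hg hpres hsat hsing hmul hadd

/-! ## v9: the CORE vocabulary (valuative weak Seidenberg for derivations of a 2-dim regular local ring)

All CORE stubs are registered in EXPANDED form; the named predicates here document the expansions
(and agree with them by `Iff.rfl`). `R : Subring K` is a two-dimensional regular local ring of `K`,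
`D : Derivation ℤ K K`. -/

section Core

open Literature.AlgebraicGeometry.Resolution

variable {K : Type} [Field K]

/-- (VAL) for the pair `(x, y)`: the values of `D` on `R` lie in `R·Dx + R·Dy`. [folklore] -/
def ValSpan (D : Derivation ℤ K K) (R : Subring K) (x y : R) : Prop :=
  ∀ f : R, ∃ a b : R, D (f : K) = (a : K) * D (x : K) + (b : K) * D (y : K)

/-- ADDITIVE(R, D): every multiple `g • D` mapping `R` into itself is SINGULAR (`gD(R) ⊆ 𝔪`) with
NILPOTENT linear part (`(gD)²(𝔪) ⊆ 𝔪²`; on the plane `𝔪/𝔪²` nilpotent = square zero).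
[cite: doi:10.1070/im1976v010n06abeh001833, §1 (additive vs multiplicative type)] -/
def Additive (D : Derivation ℤ K K) (R : Subring K) [IsLocalRing R] : Prop :=
  ∀ g : K, (∀ f : R, g * D (f : K) ∈ R) →
    (∀ f : R, ∃ w : R, w ∈ IsLocalRing.maximalIdeal R ∧ (w : K) = g * D (f : K)) ∧
    (∀ f : R, f ∈ IsLocalRing.maximalIdeal R →
      ∃ w : R, w ∈ IsLocalRing.maximalIdeal R ^ 2 ∧ (w : K) = g * D (g * D (f : K)))

/-- GOOD(R, D): some non-zero multiple `g • D ↷ R` is NON-SINGULAR (a value is a unit of `R`), or is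
singular, SATURATED (no non-zero non-unit divides all values) and has NON-NILPOTENT linear part.
[cite: Giraud1983, 2.7 (***) ; arXiv:2405.05735, §4] -/
def Good (D : Derivation ℤ K K) (R : Subring K) [IsLocalRing R] : Prop :=
  ∃ g : K, g ≠ 0 ∧ (∀ f : R, g * D (f : K) ∈ R) ∧
    ((∃ f : R, g * D (f : K) ≠ 0 ∧ (g * D (f : K))⁻¹ ∈ R) ∨
      ((∀ f : R, ∃ w : R, w ∈ IsLocalRing.maximalIdeal R ∧ (w : K) = g * D (f : K)) ∧
        (∃ f : R, f ∈ IsLocalRing.maximalIdeal R ∧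
          ∀ w : R, (w : K) = g * D (g * D (f : K)) → w ∉ IsLocalRing.maximalIdeal R ^ 2) ∧
        (∀ t : R, t ∈ IsLocalRing.maximalIdeal R → t ≠ 0 →
          ∃ f : R, ∀ w : R, (w : K) = g * D (f : K) → ¬ t ∣ w)))

/-- FREE log relation: `(A, B)` are the logarithmic coefficients (basis `dx/x, dy`) of a 1-form
annihilating `D`. [cite: Giraud1983, 2.5] -/
def FreeRel (D : Derivation ℤ K K) {R : Subring K} (x y A B : R) : Prop :=
  (A : K) * D (x : K) + (x : K) * (B : K) * D (y : K) = 0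

/-- CROSSING log relation (basis `dx/x, dy/y`). [cite: Giraud1983, 2.8] -/
def CrossRel (D : Derivation ℤ K K) {R : Subring K} (x y A B : R) : Prop :=
  (A : K) * (y : K) * D (x : K) + (B : K) * (x : K) * D (y : K) = 0

end Core

/-! ## v9: the CORE stubs (expanded signatures) -/

section CoreStubs

open Literature.AlgebraicGeometry.Resolution IsLocalRing

/-- STUB `stub_lengthWeakTransform` (PROVABLE, L). **Giraud's Lemma 2.1.1 at one point of one chart,
unconditionally.** `R ⊆ K` a two-dimensional regular local ring with regular system of parameters
`(x, y)`, `J ⊆ 𝔪^r` an ideal of finite colength with `J ⊄ 𝔪^{r+1}` (order exactly `r`), `Q` any prime of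
the chart `A = R[y/x]`, `J^w = (JA : x^r)` the weak transform. Then `A_Q/J^w A_Q` has finite length and
`λ_{A_Q}(A_Q / J^w A_Q) + λ_R(R/𝔪^r) ≤ λ_R(R/J)`. Proof route (no hypothesis on the initial forms, unlike
`length_quotient_weakTransform_map_lt`): `F := {s ∈ A | x^r s ∈ 𝔪^r}` (the `R`-span of `1, y/x, …, (y/x)^r`)
maps ONTO `A/(J^w + x^N A)` for every `N` — the graded piece `(x^k A + J^w)/(x^{k+1} A + J^w)` is a
quotient of `A/(xA + J^w)`, itself a quotient of `κ[Y]/(P̄)` with `P̄ ≠ 0` of degree `≤ r` (the class of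
`g/x^r`, `g ∈ J` of order `r`), hence spanned by the classes of `x^k (y/x)^j`, `j < r`, which lie in `F`;
so `λ_R(A/(J^w + x^N A)) ≤ λ_R(F/J') ≤ λ_R(𝔪^r/J) = λ(R/J) − λ(R/𝔪^r)` uniformly in `N`
(`F ≅ 𝔪^r` by `s ↦ x^r s`, and `J ↦` a submodule of `J^w`); the chain `J^w + x^N A` localised at `Q`
stabilises, Nakayama gives `x^N ∈ J^w A_Q`, and lengths do not grow under localisation
(`length_quotient_map_le_of_isLocalization`). Tree: `QuadraticTransformWeakTransform.lean`
(`chartAdjoin`, `weakTransformChart`, `exists_pow_mul_eq_chartIncl`, `map_maximalIdeal_chartIncl`,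
`weakTransform_not_le_span`), `QuadraticTransformColength.lean` (`comap_map_pow_maximalIdeal`).
[cite: Giraud1983, Lemma 2.1.1] -/
theorem stub_lengthWeakTransform :
    ∀ (K : Type) [Field K] (R : Subring K) [IsRegularLocalRing R] (x y : R),
    ringKrullDim R = 2 → maximalIdeal R = Ideal.span {x, y} → x ≠ 0 →
    ∀ (J : Ideal R) (r : ℕ), J ≤ maximalIdeal R ^ r → ¬ J ≤ maximalIdeal R ^ (r + 1) →
    IsFiniteLength R (R ⧸ J) →
    ∀ (Q : Ideal (chartAdjoin (K := K) x y)) [Q.IsPrime],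
    IsFiniteLength (LocalSubring.ofPrime (chartAdjoin (K := K) x y) Q).toSubring
        ((LocalSubring.ofPrime (chartAdjoin (K := K) x y) Q).toSubring ⧸
          (weakTransformChart x y J r).map
            (algebraMap (chartAdjoin (K := K) x y)
              (LocalSubring.ofPrime (chartAdjoin (K := K) x y) Q).toSubring)) ∧
      Module.length (LocalSubring.ofPrime (chartAdjoin (K := K) x y) Q).toSubring
          ((LocalSubring.ofPrime (chartAdjoin (K := K) x y) Q).toSubring ⧸
            (weakTransformChart x y J r).map
              (algebraMap (chartAdjoin (K := K) x y)
                (LocalSubring.ofPrime (chartAdjoin (K := K) x y) Q).toSubring)) +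
        Module.length R (R ⧸ maximalIdeal R ^ r) ≤ Module.length R (R ⧸ J) := by
  sorry

/-- STUB `stub_crossingStep` (PROVABLE, L). **Giraud 2.3 (i) at one point: from a CROSSING state the
potential drops strictly.** `R ⊆ K` two-dimensional regular local, dominated by the valuation ring `O`,
with perfect residue field, `𝔪 = (x, y)`, `D` a derivation of `K` with `D(R) ⊆ R·Dx + R·Dy`, not both
`Dx, Dy` zero; `(A, B)` of finite colength, `≠ R`, with `A·y·Dx + B·x·Dy = 0`; `y/x ∈ O` (the chart of
`x` contains the next centre). Let `R₁ = (R[y/x])_{𝔪_O ∩ R[y/x]}` (assumed two-dimensional; it is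
regular by `IsQuadraticTransformAlong.isRegularLocalRing_of_isRegularLocalRing`). Then `R₁` carries a
state `(x₁ = x, y₁, A₁, B₁)` with `D(R₁) ⊆ R₁·Dx₁ + R₁·Dy₁`, finite colength, STRICTLY SMALLER colength,
which is CROSSING with `y₁ = y/x` (the centre is the origin of the chart: `y/x ∈ 𝔪_O`) or FREE (the
centre is a free point of the exceptional curve). Proof: the logarithmic form `A dx/x + B dy/y` pulls
back to `(A + B) dx/x + B dy₁/y₁` (`y = x y₁`, `dy/y = dx/x + dy₁/y₁`); at the origin and, after
multiplying the second coefficient by the unit `1/y₁`, at a free point, the new log pair generates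
`(A, B)·R₁ = x^m · J^w R₁` (`m = ord (A,B) ≥ 1`), so `(A₁, B₁) := ` generators of the weak transform and
`c₁ ≤ λ(R[y/x]_Q/J^w) ≤ c − λ(R/𝔪^m) < c` by `stub_lengthWeakTransform`; at a free point with local
parameter `y₁ = P̃(y/x)` (`P` separable as the residue field is perfect, or `y₁ = y/x − t̃`),
`D y₁ ∈ unit·D(y/x) + R₁·Dx`, which transports (VAL) and only changes `(A₁, B₁)` by a unimodular
triangular matrix — this parameter is SUPPLIED as the hypothesis `∃ x₁ y₁ u e, …` (`stub_sepParam`). [cite: Giraud1983, Lemma 2.3 (i) and 2.5] -/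
theorem stub_crossingStep :
    ∀ (K : Type) [Field K] (O : ValuationSubring K) (D : Derivation ℤ K K)
    (R : Subring K) [IsRegularLocalRing R], ringKrullDim R = 2 →
    SubringDominates R O.toSubring → PerfectField (ResidueField R) →
    ∀ (x y A B : R), maximalIdeal R = Ideal.span {x, y} →
    (∀ f : R, ∃ a b : R, D (f : K) = (a : K) * D (x : K) + (b : K) * D (y : K)) →
    (D (x : K) ≠ 0 ∨ D (y : K) ≠ 0) →
    (A : K) * (y : K) * D (x : K) + (B : K) * (x : K) * D (y : K) = 0 →
    IsFiniteLength R (R ⧸ Ideal.span {A, B}) → Ideal.span {A, B} ≠ ⊤ →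
    ((y : R) : K) / ((x : R) : K) ∈ O →
    ∀ (R₁ : Subring K) [IsRegularLocalRing R₁], R₁ = locAtCentre (chartAdjoin (K := K) x y) O →
    ringKrullDim R₁ = 2 →
    (∃ (x₁ y₁ u e : R₁), (x₁ : K) = x ∧ maximalIdeal R₁ = Ideal.span {x₁, y₁} ∧ IsUnit u ∧
      D (y₁ : K) = (u : K) * D (((y : R) : K) / ((x : R) : K)) + (e : K) * D (x : K)) →
    ∃ (x₁ y₁ A₁ B₁ : R₁), (x₁ : K) = x ∧ maximalIdeal R₁ = Ideal.span {x₁, y₁} ∧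
      (∀ f : R₁, ∃ a b : R₁, D (f : K) = (a : K) * D (x₁ : K) + (b : K) * D (y₁ : K)) ∧
      IsFiniteLength R₁ (R₁ ⧸ Ideal.span {A₁, B₁}) ∧
      Module.length R₁ (R₁ ⧸ Ideal.span {A₁, B₁}) < Module.length R (R ⧸ Ideal.span {A, B}) ∧
      (((y₁ : K) = ((y : R) : K) / ((x : R) : K) ∧
          (A₁ : K) * (y₁ : K) * D (x₁ : K) + (B₁ : K) * (x₁ : K) * D (y₁ : K) = 0) ∨
        (A₁ : K) * D (x₁ : K) + (x₁ : K) * (B₁ : K) * D (y₁ : K) = 0) := by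
  sorry

/-- STUB `stub_freeStepSame` (PROVABLE, L). **Giraud 2.3 (ii) at one point, sharpened by nilpotency:
from an ADDITIVE FREE state whose next centre lies in the chart of the boundary parameter, the
potential drops strictly.** Data as in `stub_crossingStep` but with the FREE relation
`A·Dx + x·B·Dy = 0` (boundary `x = 0`), ADDITIVE(R, D) (every `gD ↷ R` is singular with nilpotent
linear part), and `y/x ∈ O`. Then `R₁ = (R[y/x])_{𝔪_O ∩ R[y/x]}` (assumed two-dimensional) carries a FREE
state `(x₁ = x, y₁, A₁, B₁)` of STRICTLY SMALLER colength. Proof: the log form `A dx/x + B dy` pulls back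
to `(A + x y' B) dx/x + x B dy'` (`y = x y'`); with `a₀ = ord A`, `b₀ = ord B`, `m = min`:
(A) `b₀ < a₀`: the primitive part of the new pair is `(x^{a₀-b₀-1} Ã, B̃)` (`A = x^{a₀} Ã`, `B = x^{b₀} B̃`
in the chart), which CONTAINS the weak transform `J^w = (x^{a₀-b₀} Ã, B̃)` of `(A, B)`, so
`c₁ ≤ λ(R₁/J^w) < c` (`stub_lengthWeakTransform`); (B) `a₀ = m ≤ b₀`: the new pair is
`H' = (Ã + x^{b₀-m+1} y' B̃, x^{b₀-m+1} B̃) ⊆ J^w = (Ã, x^{b₀-m} B̃)`, and `J^w/H'` is cyclic, killed by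
`(x, Ã)`, of length `≤ deg(Ã mod x) ≤ m`, so `c₁ ≤ c − λ(R/𝔪^m) + m < c` when `m ≥ 2`; if `m = 1`: apply
ADDITIVE to `g := A / Dy` (`gDy = A`, `gDx = −xB`, `gD ↷ R` by (VAL)): nilpotency gives
`gD(A) ≡ a₀₁·A ∈ 𝔪²` for `A ≡ a₁₀ x + a₀₁ y`, whence `a₀₁ = 0`, `A ≡ a₁₀ x (mod 𝔪²)` with `a₁₀` a unit,
so `Ã = A/x` is a unit modulo `x` on the whole chart and `H' = R₁`, `c₁ = 0 < c` (`c ≥ 1` as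
`(A,B) ≠ R`, which follows from ADDITIVE: were `(A,B) = R`, `gD` above would be non-singular or have an
eigenvalue). Transport of (VAL) and of the relation to the local parameter `y₁` at the centre as in
`stub_crossingStep` (the parameter `y₁` with unit derivative is SUPPLIED as a hypothesis, `stub_sepParam`). [cite: Giraud1983, Lemma 2.3 (ii), 2.5 (A)/(B)] -/
theorem stub_freeStepSame :
    ∀ (K : Type) [Field K] (O : ValuationSubring K) (D : Derivation ℤ K K)
    (R : Subring K) [IsRegularLocalRing R], ringKrullDim R = 2 →
    SubringDominates R O.toSubring → PerfectField (ResidueField R) →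
    ∀ (x y A B : R), maximalIdeal R = Ideal.span {x, y} →
    (∀ f : R, ∃ a b : R, D (f : K) = (a : K) * D (x : K) + (b : K) * D (y : K)) →
    (D (x : K) ≠ 0 ∨ D (y : K) ≠ 0) →
    (A : K) * D (x : K) + (x : K) * (B : K) * D (y : K) = 0 →
    IsFiniteLength R (R ⧸ Ideal.span {A, B}) → Ideal.span {A, B} ≠ ⊤ →
    (∀ g : K, (∀ f : R, g * D (f : K) ∈ R) →
      (∀ f : R, ∃ w : R, w ∈ maximalIdeal R ∧ (w : K) = g * D (f : K)) ∧
      (∀ f : R, f ∈ maximalIdeal R →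
        ∃ w : R, w ∈ maximalIdeal R ^ 2 ∧ (w : K) = g * D (g * D (f : K)))) →
    ((y : R) : K) / ((x : R) : K) ∈ O →
    ∀ (R₁ : Subring K) [IsRegularLocalRing R₁], R₁ = locAtCentre (chartAdjoin (K := K) x y) O →
    ringKrullDim R₁ = 2 →
    (∃ (x₁ y₁ u e : R₁), (x₁ : K) = x ∧ maximalIdeal R₁ = Ideal.span {x₁, y₁} ∧ IsUnit u ∧
      D (y₁ : K) = (u : K) * D (((y : R) : K) / ((x : R) : K)) + (e : K) * D (x : K)) →
    ∃ (x₁ y₁ A₁ B₁ : R₁), (x₁ : K) = x ∧ maximalIdeal R₁ = Ideal.span {x₁, y₁} ∧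
      (∀ f : R₁, ∃ a b : R₁, D (f : K) = (a : K) * D (x₁ : K) + (b : K) * D (y₁ : K)) ∧
      (A₁ : K) * D (x₁ : K) + (x₁ : K) * (B₁ : K) * D (y₁ : K) = 0 ∧
      IsFiniteLength R₁ (R₁ ⧸ Ideal.span {A₁, B₁}) ∧
      Module.length R₁ (R₁ ⧸ Ideal.span {A₁, B₁}) < Module.length R (R ⧸ Ideal.span {A, B}) := by
  sorry

/-- STUB `stub_freeStepOther` (PROVABLE, M/L). **Giraud 2.3 (ii) at the satellite point: from a FREE
state whose next centre is NOT in the chart of the boundary parameter (`v(y) < v(x)`: the centre of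
`O` on the blow-up is the crossing point of the new exceptional curve `y = 0` with the strict transform
`x/y = 0` of the old boundary), the potential does not increase.** `R₁ = (R[x/y])_{𝔪_O ∩ R[x/y]}`
(assumed two-dimensional) carries a CROSSING state `(x₁ = x/y, y₁ = y, A₁, B₁)` with `c₁ ≤ c`. Proof:
`A dx/x + B dy = A dx₁/x₁ + (A + yB) dy/y`; with `A = y^{a₀} Â`, `B = y^{b₀} B̂` in the chart:
(A) `b₀ < a₀`: new pair `(y^{a₀-b₀-1} Â, B̂) ⊇ J^w`, `c₁ < c`; (B) `a₀ = m ≤ b₀`: new pair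
`(Â, y^{b₀-m+1} B̂) ⊆ J^w = (Â, y^{b₀-m} B̂)` with cyclic quotient killed by `(y, Â)`, of length `≤ m`, so
`c₁ ≤ c − λ(R/𝔪^m) + m ≤ c` (`λ(R/𝔪^m) ≥ m`). Uses `stub_lengthWeakTransform` for the chart `R[x/y]`
(roles of `x, y` exchanged). [cite: Giraud1983, Lemma 2.3 (ii), 2.5] -/
theorem stub_freeStepOther :
    ∀ (K : Type) [Field K] (O : ValuationSubring K) (D : Derivation ℤ K K)
    (R : Subring K) [IsRegularLocalRing R], ringKrullDim R = 2 →
    SubringDominates R O.toSubring → PerfectField (ResidueField R) →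
    ∀ (x y A B : R), maximalIdeal R = Ideal.span {x, y} →
    (∀ f : R, ∃ a b : R, D (f : K) = (a : K) * D (x : K) + (b : K) * D (y : K)) →
    (D (x : K) ≠ 0 ∨ D (y : K) ≠ 0) →
    (A : K) * D (x : K) + (x : K) * (B : K) * D (y : K) = 0 →
    IsFiniteLength R (R ⧸ Ideal.span {A, B}) → Ideal.span {A, B} ≠ ⊤ →
    ((y : R) : K) / ((x : R) : K) ∉ O →
    ∀ (R₁ : Subring K) [IsRegularLocalRing R₁], R₁ = locAtCentre (chartAdjoin (K := K) y x) O →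
    ringKrullDim R₁ = 2 →
    ∃ (x₁ y₁ A₁ B₁ : R₁), (x₁ : K) = ((x : R) : K) / ((y : R) : K) ∧ (y₁ : K) = y ∧
      maximalIdeal R₁ = Ideal.span {x₁, y₁} ∧
      (∀ f : R₁, ∃ a b : R₁, D (f : K) = (a : K) * D (x₁ : K) + (b : K) * D (y₁ : K)) ∧
      (A₁ : K) * (y₁ : K) * D (x₁ : K) + (B₁ : K) * (x₁ : K) * D (y₁ : K) = 0 ∧
      IsFiniteLength R₁ (R₁ ⧸ Ideal.span {A₁, B₁}) ∧
      Module.length R₁ (R₁ ⧸ Ideal.span {A₁, B₁}) ≤ Module.length R (R ⧸ Ideal.span {A, B}) := by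
  sorry

/-- STUB `stub_sepParam` (PROVABLE, M/L). **A regular parameter at the centre of the chart with unit derivative**
(the one place where perfectness of the residue field enters the engine). `R ⊆ K` two-dimensional regular local with
`𝔪 = (x, y)` and PERFECT residue field `κ`, dominated by `O`, `y/x ∈ O`, `R₁ = (R[y/x])_{𝔪_O ∩ R[y/x]}` (assumed regular of
dimension two), `D` any derivation of `K` with `D(R) ⊆ R·Dx + R·Dy`. Then `𝔪_{R₁} = (x, y₁)` for some `y₁` with
`D y₁ = u · D(y/x) + e · Dx`, `u` a UNIT of `R₁`, `e ∈ R₁`. Proof: the centre `Q ∋ x` of `O` on `𝒜 = R[y/x]` corresponds to a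
prime of `𝒜/x𝒜 ≅ κ[Y]` (`Y ↦ y' := y/x`; `QuadraticTransformsChart.lean`: `𝒜 ≅ R[X]/(xX − y)`-presentation, `isPrime_map_incl`,
`map_incl_span_pair`); it is maximal (else `Q = x𝒜` and `R₁` would be a discrete valuation ring, not of dimension two), generated
by an irreducible `P̄ ∈ κ[Y]`, SEPARABLE as `κ` is perfect (`PerfectField.separable_of_irreducible`); for a monic lift `P ∈ R[Y]`
put `y₁ := P(y')`: then `Q = (x, y₁)𝒜`, so `𝔪₁ = (x, y₁)`, and `D y₁ = P'(y') Dy' + Σ (D cᵢ) y'^i` with `P'(y') ∉ Q` (as `P̄'` is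
prime to `P̄`) and `D cᵢ = aᵢ Dx + bᵢ Dy = (aᵢ + bᵢ y') Dx + bᵢ x Dy'`; hence `u = P'(y') + x Σ bᵢ y'^i` (a unit) and
`e = Σ (aᵢ + bᵢ y') y'^i`. (Rational centre `y' ≡ t`: `P = Y − t`; origin: `P = Y`.) [folklore; cf. Giraud1983, 2.5
("quitte à passer à un revêtement étale")] -/
theorem stub_sepParam :
    ∀ (K : Type) [Field K] (O : ValuationSubring K) (D : Derivation ℤ K K)
    (R : Subring K) [IsRegularLocalRing R], ringKrullDim R = 2 →
    SubringDominates R O.toSubring → PerfectField (ResidueField R) →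
    ∀ (x y : R), maximalIdeal R = Ideal.span {x, y} →
    (∀ f : R, ∃ a b : R, D (f : K) = (a : K) * D (x : K) + (b : K) * D (y : K)) →
    ((y : R) : K) / ((x : R) : K) ∈ O →
    ∀ (R₁ : Subring K) [IsRegularLocalRing R₁], R₁ = locAtCentre (chartAdjoin (K := K) x y) O →
    ringKrullDim R₁ = 2 →
    ∃ (x₁ y₁ u e : R₁), (x₁ : K) = x ∧ maximalIdeal R₁ = Ideal.span {x₁, y₁} ∧ IsUnit u ∧
      D (y₁ : K) = (u : K) * D (((y : R) : K) / ((x : R) : K)) + (e : K) * D (x : K) := by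
  sorry

/-- STUB `stub_goodOfTop` (PROVABLE, M). **A state of colength zero is GOOD.** If the log pair
generates `R` then some `g ≠ 0` has `gD ↷ R` non-singular, or singular, saturated and with
non-nilpotent linear part. Proof (FREE, `A·Dx + x·B·Dy = 0`): `(Dx, Dy)` is proportional to
`(−xB, A)`; if `x ∤ A` take `gD = e(−xB ∂… )`, i.e. `g` with `(gDx, gDy) = (−xB, A)`: `A` a unit ⇒
non-singular (`gDy` unit); `A ∈ 𝔪` ⇒ `B` unit, `gD` singular, saturated (`gcd(xB, A) = 1`), and
`gD(x) = −xB ≡ −B₀ x (mod 𝔪²)` gives the eigenvalue `−B₀ ≠ 0`; if `A = x A₁` (so `B` is a unit):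
`(gDx, gDy) = (−B, A₁)`, non-singular. CROSSING (`A·y·Dx + B·x·Dy = 0`): `(Dx, Dy) ∝ (−xB, yA)`; with
`A` a unit: `y ∤ B` ⇒ `(gDx, gDy) = (−xB, yA)`, singular, saturated, eigenvalue `A₀` on `ȳ`; `y ∣ B` ⇒
`(−xB/y, A)`, non-singular; symmetrically for `B` a unit. (VAL) gives `gD(R) ⊆ R·gDx + R·gDy ⊆ R` and
identifies the ideal of values with `(gDx, gDy)` for saturation. [folklore; cf. Giraud1983, Lemma 2.8] -/
theorem stub_goodOfTop :
    ∀ (K : Type) [Field K] (D : Derivation ℤ K K) (R : Subring K) [IsRegularLocalRing R],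
    ringKrullDim R = 2 → ∀ (x y A B : R), maximalIdeal R = Ideal.span {x, y} →
    (∀ f : R, ∃ a b : R, D (f : K) = (a : K) * D (x : K) + (b : K) * D (y : K)) →
    (D (x : K) ≠ 0 ∨ D (y : K) ≠ 0) →
    ((A : K) * D (x : K) + (x : K) * (B : K) * D (y : K) = 0 ∨
      (A : K) * (y : K) * D (x : K) + (B : K) * (x : K) * D (y : K) = 0) →
    Ideal.span {A, B} = ⊤ →
    ∃ g : K, g ≠ 0 ∧ (∀ f : R, g * D (f : K) ∈ R) ∧
      ((∃ f : R, g * D (f : K) ≠ 0 ∧ (g * D (f : K))⁻¹ ∈ R) ∨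
        ((∀ f : R, ∃ w : R, w ∈ maximalIdeal R ∧ (w : K) = g * D (f : K)) ∧
          (∃ f : R, f ∈ maximalIdeal R ∧
            ∀ w : R, (w : K) = g * D (g * D (f : K)) → w ∉ maximalIdeal R ^ 2) ∧
          (∀ t : R, t ∈ maximalIdeal R → t ≠ 0 →
            ∃ f : R, ∀ w : R, (w : K) = g * D (f : K) → ¬ t ∣ w))) := by
  sorry

/-- STUB `stub_coreDescent` (PROVABLE, L — the lead's). **Valuative weak Seidenberg theorem.** Let
`R₀ → R₁ → ⋯` be an infinite sequence of quadratic transforms along the valuation ring `O` of `K`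
(`IsQuadraticTransformAlong`), all two-dimensional regular local rings with perfect residue fields,
`R₀` dominated by `O`, and `D` a derivation of `K` with `D(R₀) ⊆ R₀·Dx + R₀·Dy` for a regular system of
parameters `(x, y)` of `R₀` on which `D` does not vanish. Then some `R_n` is GOOD: some `g ≠ 0` has
`gD ↷ R_n` non-singular, or singular, saturated, with non-nilpotent linear part. Proof: if no `R_n` is
GOOD then every `R_n` is ADDITIVE (saturate by the gcd of `(gDx, gDy)` in the UFD `R_n`); start with the
FREE state at `R₀` given by the primitive vector of `(−x·Dy, Dx)`; by `stub_freeStepSame` /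
`stub_freeStepOther` / `stub_crossingStep` the states propagate along the sequence (each `R_{n+1}` is
`locAtCentre (chartAdjoin x y) O` or `locAtCentre (chartAdjoin y x) O` according as `y/x ∈ O`, by
`IsQuadraticTransformAlong.exists_eq_locAtCentre` / `unique` and `blowupRing_eq_adjoin`), with colength
`≥ 1` (`stub_goodOfTop`), non-increasing and strictly decreasing at least every second step —
impossible. (Induction on the colength.) [cite: Giraud1983, Thm. 2.4 / 2.10 (valuative form)] -/
theorem stub_coreDescent :
    ∀ (K : Type) [Field K] (O : ValuationSubring K) (D : Derivation ℤ K K) (R : ℕ → Subring K)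
    (hreg : ∀ n, IsRegularLocalRing (R n)), (∀ n, ringKrullDim (R n) = 2) →
    SubringDominates (R 0) O.toSubring → (∀ n, IsQuadraticTransformAlong O (R n) (R (n + 1))) →
    (∀ n, haveI := hreg n; PerfectField (ResidueField (R n))) →
    (haveI := hreg 0; ∃ x y : R 0, maximalIdeal (R 0) = Ideal.span {x, y} ∧
      (∀ f : R 0, ∃ a b : R 0, D (f : K) = (a : K) * D (x : K) + (b : K) * D (y : K)) ∧
      (D (x : K) ≠ 0 ∨ D (y : K) ≠ 0)) →
    ∃ n : ℕ, haveI := hreg n;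
      ∃ g : K, g ≠ 0 ∧ (∀ f : R n, g * D (f : K) ∈ R n) ∧
      ((∃ f : R n, g * D (f : K) ≠ 0 ∧ (g * D (f : K))⁻¹ ∈ R n) ∨
        ((∀ f : R n, ∃ w : R n, w ∈ maximalIdeal (R n) ∧ (w : K) = g * D (f : K)) ∧
          (∃ f : R n, f ∈ maximalIdeal (R n) ∧
            ∀ w : R n, (w : K) = g * D (g * D (f : K)) → w ∉ maximalIdeal (R n) ^ 2) ∧
          (∀ t : R n, t ∈ maximalIdeal (R n) → t ≠ 0 →
            ∃ f : R n, ∀ w : R n, (w : K) = g * D (f : K) → ¬ t ∣ w))) := by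
  sorry

/-- STUB `stub_valSpan` (PROVABLE, M/L). **(VAL) at the centre of a finitely generated model of a
function field of transcendence degree two over a perfect field.** `k` perfect of characteristic `p`,
`K/k` with `Algebra.trdeg k K ≤ 2`, `S ≤ O` f.g. with `Frac S = K`, `R = S_c = locAtCentre S O`
regular of dimension two with `𝔪_R = (x, y)`, `D` a `k`-derivation of `K`: then
`D(f) ∈ R·D(x) + R·D(y)` for all `f ∈ R`. Proof: `R` is essentially of finite type and regular over a
field of characteristic `p`, hence formally smooth over `𝔽_p`
(`formallySmooth_zmod_of_isRegularLocalRing_of_essFiniteType`), so there are derivations `∂₁, ∂₂`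
of `R` with `∂ᵢ(x) = δᵢ₁`, `∂ᵢ(y) = δᵢ₂` (`exists_dual_derivations`, `DualDerivationsPrimeField.lean`);
the derivation `E = D − D(x)·∂₁ − D(y)·∂₂ : R → K` kills `x, y` and `K^p`; and `K = K^p(x, y)`:
`[K : K^p] ≤ p²` (separating transcendence basis `t₁, t₂` over the perfect `k`, `K = k(t)(θ)` with `θ`
separable, `k(t)(θ) = k(t)(θ^p)`), while `1, …, x^i y^j, … (i, j < p)` are `K^p`-independent (`x ∉ K^p`
as a prime of the UFD `R`; `y ∉ K^p(x)` by reduction modulo `x`, where `R/(x)` is a DVR with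
uniformiser `ȳ`, and descent). Hence `E = 0` on `R`. (The centre is a closed point: `dim R = 2 = trdeg`.)
[cite: Matsumura1987, Thm. 30.6 (ii); Giraud1983, 1.1 (differential coordinates)] -/
theorem stub_valSpan :
    ∀ p : ℕ, p.Prime → ∀ (k K : Type) [Field k] [CharP k p] [PerfectField k] [Field K] [Algebra k K]
    (O : ValuationSubring K) (S : Subalgebra k K), S.toSubring ≤ O.toSubring →
    ∀ (D : Derivation k K K), S.FG → IsFractionRing S K → Algebra.trdeg k K ≤ 2 →
    ∀ [IsRegularLocalRing (locAtCentre S.toSubring O)],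
    ringKrullDim (locAtCentre S.toSubring O) = 2 →
    ∀ (x y : locAtCentre S.toSubring O),
    maximalIdeal (locAtCentre S.toSubring O) = Ideal.span {x, y} →
    ∀ f : locAtCentre S.toSubring O, ∃ a b : locAtCentre S.toSubring O,
      D (f : K) = (a : K) * D (x : K) + (b : K) * D (y : K) := by
  sorry

/-- STUB `stub_fgTower` (PROVABLE, M). **Every member of the quadratic sequence of `S_c` along `O` is
the local ring at the centre of a finitely generated model containing `S`.** For `S ≤ O` a f.g.
`k`-subalgebra with `Frac S = K` and every `n`, some f.g. `S ≤ Sₙ ≤ O` with `Frac Sₙ = K` has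
`locAtCentre Sₙ O = quadraticSeq O (locAtCentre S O) n`. Proof: induction; a quadratic transform along
`O` of `locAtCentre Sₙ O` is `locAtCentre (closure (locAtCentre Sₙ O ∪ u/u₀)) O`
(`IsQuadraticTransformAlong.exists_eq_locAtCentre`, `blowupRing_eq_closure_of_span_eq` with generators
`u ⊆ Sₙ` of the centre — numerators of generators of the maximal ideal, denominators being units), and
`locAtCentre (closure (locAtCentre B O ∪ t)) O = locAtCentre (closure (B ∪ t)) O`
(`LocalBlowup.lean`: `locAtCentre_locAtCentre`, `exists_eq_locAtCentre_of_reflTransGen`); when no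
transform exists the sequence is stationary. [folklore; cf. NovacoskiSpivakovsky2014, Lemma 2.9] -/
theorem stub_fgTower :
    ∀ (k K : Type) [Field k] [Field K] [Algebra k K] (O : ValuationSubring K) (S : Subalgebra k K),
    S.toSubring ≤ O.toSubring → S.FG → IsFractionRing S K → ∀ n : ℕ,
    ∃ (S' : Subalgebra k K), S'.toSubring ≤ O.toSubring ∧ S ≤ S' ∧ S'.FG ∧ IsFractionRing S' K ∧
      locAtCentre S'.toSubring O = quadraticSeq O (locAtCentre S.toSubring O) n := by
  sorry

end CoreStubs

/-! ## v9: the two registered halves of the open core -/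

/-- STUB `stub_additiveExitLow` (PROVABLE from the CORE stubs — the lead's assembly). **`FolLU` on
saturated additive input in transcendence degree `≤ 2`.** Proof plan: `R₀ := S_c = locAtCentre S O`.
If `dim R₀ ≤ 1`, or some member of the quadratic sequence `quadraticSeq O R₀` has dimension `≤ 1`, that
member is a discrete valuation ring dominated by (hence equal to) `O`, so `O` is essentially of finite
type and `stub_folLU_of_essFiniteType` (landed) concludes (with `stub_fgTower` for the model). Otherwise
all members are two-dimensional regular (`IsQuadraticTransformAlong.isRegularLocalRing_of_isRegularLocalRing`)
with residue fields finite over the perfect `k` (closed points: `dim = 2 = trdeg`), (VAL) holds at `R₀`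
(`stub_valSpan`), `D ≠ 0` on `(x, y)`, so `stub_coreDescent` yields a GOOD `R_n = (S_n)_c`
(`stub_fgTower`): `g • D ↷ S_n,c` NON-SINGULAR (first clause of the crux), or singular saturated with
non-nilpotent linear part `L`; in the latter case `(g•D)^p = c'·(g•D)` on `K` (`stub_rescale_pClosed`),
`c' ∈ S_n,c` (`stub_multiplier_inCtr`, saturation), and `L^p = c̄' L` with `L` non-nilpotent forces
`c̄' ≠ 0`: MULTIPLICATIVE. [cite: Giraud1983, Thm. 2.4; arXiv:2405.05735, Thm. 4.0.1] -/
theorem stub_additiveExitLow :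
  ∀ p : ℕ, p.Prime → ∀ (k K : Type) [Field k] [CharP k p] [PerfectField k] [Field K] [Algebra k K]
    (O : ValuationSubring K) (S : Subalgebra k K) (hS : S.toSubring ≤ O.toSubring)
    (D : Derivation k K K) (g c : K), S.FG → IsFractionRing S K →
    IsRegularLocalRing
      (Localization.AtPrime (Ideal.comap (Subring.inclusion hS) (IsLocalRing.maximalIdeal O))) →
    D ≠ 0 → (∃ c₀ : K, ∀ x : K, (⇑D)^[p] x = c₀ * D x) → Algebra.trdeg k K ≤ 2 → g ≠ 0 →
    (∀ x : K, (∃ a b : K, a ∈ S ∧ b ∈ S ∧ b ≠ 0 ∧ b⁻¹ ∈ O ∧ x = a / b) →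
      ∃ a b : K, a ∈ S ∧ b ∈ S ∧ b ≠ 0 ∧ b⁻¹ ∈ O ∧ (g • D) x = a / b) →
    (∀ t : K, ((∃ a b : K, a ∈ S ∧ b ∈ S ∧ b ≠ 0 ∧ b⁻¹ ∈ O ∧ t = a / b) ∧ ¬ (t ≠ 0 ∧ t⁻¹ ∈ O)) →
      t ≠ 0 → ∃ x : K, (∃ a b : K, a ∈ S ∧ b ∈ S ∧ b ≠ 0 ∧ b⁻¹ ∈ O ∧ x = a / b) ∧
        ¬ (∃ a b : K, a ∈ S ∧ b ∈ S ∧ b ≠ 0 ∧ b⁻¹ ∈ O ∧ (g • D) x / t = a / b)) →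
    ¬ (∃ x : K, (∃ a b : K, a ∈ S ∧ b ∈ S ∧ b ≠ 0 ∧ b⁻¹ ∈ O ∧ x = a / b) ∧ (g • D) x ≠ 0 ∧
      ((g • D) x)⁻¹ ∈ O) →
    ((∃ a b : K, a ∈ S ∧ b ∈ S ∧ b ≠ 0 ∧ b⁻¹ ∈ O ∧ c = a / b) ∧
      ∀ x : K, (⇑(g • D))^[p] x = c * (g • D) x) →
    ¬ (c ≠ 0 ∧ c⁻¹ ∈ O) →
    ∃ (S' : Subalgebra k K) (h' : S'.toSubring ≤ O.toSubring) (g' c' : K),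
      S ≤ S' ∧ S'.FG ∧ IsFractionRing S' K ∧
      IsRegularLocalRing
        (Localization.AtPrime (Ideal.comap (Subring.inclusion h') (IsLocalRing.maximalIdeal O))) ∧
      g' ≠ 0 ∧
      (∀ x : K, (∃ a b : K, a ∈ S' ∧ b ∈ S' ∧ b ≠ 0 ∧ b⁻¹ ∈ O ∧ x = a / b) →
        ∃ a b : K, a ∈ S' ∧ b ∈ S' ∧ b ≠ 0 ∧ b⁻¹ ∈ O ∧ (g' • D) x = a / b) ∧
      ((∃ x : K, (∃ a b : K, a ∈ S' ∧ b ∈ S' ∧ b ≠ 0 ∧ b⁻¹ ∈ O ∧ x = a / b) ∧ (g' • D) x ≠ 0 ∧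
          ((g' • D) x)⁻¹ ∈ O) ∨
        (((∃ a b : K, a ∈ S' ∧ b ∈ S' ∧ b ≠ 0 ∧ b⁻¹ ∈ O ∧ c' = a / b) ∧
            ∀ x : K, (⇑(g' • D))^[p] x = c' * (g' • D) x) ∧ (c' ≠ 0 ∧ c'⁻¹ ∈ O))) := by
  sorry

/-- STUB `stub_additiveExitHigh` (OPEN PROBLEM from dimension three). **`FolLU` on saturated additive
input when `trdeg_k K ≥ 3`.** Nothing is known in print beyond threefolds over `k = k̄` with a regular
singular curve (Posva, arXiv:2405.05735, Prop. 2.3.5 / Rem. 5.2.2) and `p = 2`, `trdeg ≤ 3`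
(Thm. 5.3.1); the relative-surface test-bed (`O ⊇ k(x)`) terminated in 4200/4200 random cases
(`Cruxes/FolLU/Disproof.lean` §3). Why it might fail: an additive point reproducing its invariants along
a valuation with three-dimensional centres (the dual kangaroo). [cite: arXiv:2405.05735, Rem. 5.2.2;
arXiv:2311.16694, Thm. 7; doi:10.1007/s13398-013-0117-7] -/
theorem stub_additiveExitHigh :
  ∀ p : ℕ, p.Prime → ∀ (k K : Type) [Field k] [CharP k p] [PerfectField k] [Field K] [Algebra k K]
    (O : ValuationSubring K) (S : Subalgebra k K) (hS : S.toSubring ≤ O.toSubring)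
    (D : Derivation k K K) (g c : K), S.FG → IsFractionRing S K →
    IsRegularLocalRing
      (Localization.AtPrime (Ideal.comap (Subring.inclusion hS) (IsLocalRing.maximalIdeal O))) →
    D ≠ 0 → (∃ c₀ : K, ∀ x : K, (⇑D)^[p] x = c₀ * D x) → ¬ Algebra.trdeg k K ≤ 2 → g ≠ 0 →
    (∀ x : K, (∃ a b : K, a ∈ S ∧ b ∈ S ∧ b ≠ 0 ∧ b⁻¹ ∈ O ∧ x = a / b) →
      ∃ a b : K, a ∈ S ∧ b ∈ S ∧ b ≠ 0 ∧ b⁻¹ ∈ O ∧ (g • D) x = a / b) →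
    (∀ t : K, ((∃ a b : K, a ∈ S ∧ b ∈ S ∧ b ≠ 0 ∧ b⁻¹ ∈ O ∧ t = a / b) ∧ ¬ (t ≠ 0 ∧ t⁻¹ ∈ O)) →
      t ≠ 0 → ∃ x : K, (∃ a b : K, a ∈ S ∧ b ∈ S ∧ b ≠ 0 ∧ b⁻¹ ∈ O ∧ x = a / b) ∧
        ¬ (∃ a b : K, a ∈ S ∧ b ∈ S ∧ b ≠ 0 ∧ b⁻¹ ∈ O ∧ (g • D) x / t = a / b)) →
    ¬ (∃ x : K, (∃ a b : K, a ∈ S ∧ b ∈ S ∧ b ≠ 0 ∧ b⁻¹ ∈ O ∧ x = a / b) ∧ (g • D) x ≠ 0 ∧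
      ((g • D) x)⁻¹ ∈ O) →
    ((∃ a b : K, a ∈ S ∧ b ∈ S ∧ b ≠ 0 ∧ b⁻¹ ∈ O ∧ c = a / b) ∧
      ∀ x : K, (⇑(g • D))^[p] x = c * (g • D) x) →
    ¬ (c ≠ 0 ∧ c⁻¹ ∈ O) →
    ∃ (S' : Subalgebra k K) (h' : S'.toSubring ≤ O.toSubring) (g' c' : K),
      S ≤ S' ∧ S'.FG ∧ IsFractionRing S' K ∧
      IsRegularLocalRing
        (Localization.AtPrime (Ideal.comap (Subring.inclusion h') (IsLocalRing.maximalIdeal O))) ∧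
      g' ≠ 0 ∧
      (∀ x : K, (∃ a b : K, a ∈ S' ∧ b ∈ S' ∧ b ≠ 0 ∧ b⁻¹ ∈ O ∧ x = a / b) →
        ∃ a b : K, a ∈ S' ∧ b ∈ S' ∧ b ≠ 0 ∧ b⁻¹ ∈ O ∧ (g' • D) x = a / b) ∧
      ((∃ x : K, (∃ a b : K, a ∈ S' ∧ b ∈ S' ∧ b ≠ 0 ∧ b⁻¹ ∈ O ∧ x = a / b) ∧ (g' • D) x ≠ 0 ∧
          ((g' • D) x)⁻¹ ∈ O) ∨
        (((∃ a b : K, a ∈ S' ∧ b ∈ S' ∧ b ≠ 0 ∧ b⁻¹ ∈ O ∧ c' = a / b) ∧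
            ∀ x : K, (⇑(g' • D))^[p] x = c' * (g' • D) x) ∧ (c' ≠ 0 ∧ c'⁻¹ ∈ O))) := by
  sorry

/-- The expanded stubs are literally the named statements. -/
example : AdditiveExitLowStatement := stub_additiveExitLow
/-- The expanded stubs are literally the named statements. -/
example : AdditiveExitHighStatement := stub_additiveExitHigh

/-- **The crux `FolLU`, assembled (v9)**: the three LANDED normalisation stubs, and the open core split
by transcendence degree into `stub_additiveExitLow` (provable: valuative weak Seidenberg in dimension
two) and `stub_additiveExitHigh` (open from dimension three). Concludes the route decl
`FoliationDescent.FolLU` BY NAME; the only `sorry`s in its closure are the two registered halves. -/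
theorem FolLU_of : FolLU :=
  FolLU_of_additiveExit stub_saturation stub_rescale_pClosed stub_multiplier_inCtr
    (additiveExit_of_lowHigh stub_additiveExitLow stub_additiveExitHigh)


end Summit.ResolutionOfSingularities.ResolutionOfSingularities.Cruxes.FolLU.Lines.Birth

end
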